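import Literature.MathematicalPhysics.QuantumFieldTheory.Balaban1983to89.B16RLeafRecord13AtLive
import Literature.MathematicalPhysics.QuantumFieldTheory.Balaban1983to89.Node00.Record13NumericsOfThm1C

/-!
# `Balaban1983to89.B16RLeafRecord13LiveRstep` — YM-DAG nodes N13∕N11 on the Stage-13 live-selector line READ FROM ROW `rstep` ALONE: the 𝐑-leaf of record,
# its law form, «𝐑 of record = identity a.e.» and Theorem 1's induction from (S1ᵀ)-at-the-live-sequences need NO `Provisos₁₃` field except def-R's (0.3)
# integrable-form provisos — hence NO row P11 `bg` — and are CLOSED THEOREMS at every live witness carrying K0b's residuals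
# ([Balaban1988Convergent] p. 244, Thm 1 p. 262, (3.24)–(3.25) p. 270; [Balaban1989LargeFieldI] (0.3)–(0.4) p. 176, (i)–(ii) p. 177; [Balaban1989LargeFieldII] Thm 1 p. 355)

statement-level bookkeeping over published theorems with citation tags; kernel-checked compositions of tree theorems;
nothing here is a claim about the Yang–Mills mass gap.

WHAT THIS FILE RECORDS (seat dag-n11-e g6; director-ym LINE №136 makes the separation caveat on row P11 — `Provisos₁₃.bg` demanded at every (2.18) index,
print's [15] Thm 1 only at separated sequences — load-bearing for every CONSUMER of `Provisos₁₃.bg`).  The live-line N11∕N13 chain of `…B16RLeafRecord13Live`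
(§1 the a.e. identity at a dead-fed fixed point, §2 the step `TLaw₁₃ k → SLaw₁₃ (k+1)` and the leaf `ROpLeaf (VOfRecord₁₃ θ p)`, §3 the (S1ᵀ)-live induction, §5
`ρ_{k+1} = 𝐓ρ_k` a.e., §6 the same at the selector clause) and of `…B16RLeafRecord13AtLive` (the re-pin and the witnesses) takes `h : θ.Provisos₁₃ F N` but READS
IT ONLY AS `h.rstep p k hk` — def-R's (0.3) provisos of the pre-𝐑 tower IN THE INTEGRABLE FORM `RepData.ProvisosInt` (integrable pieces ∧ a.e. sign ∧ the a.e.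
support clause «`∫⌈_{Z′(s′)} t_{s′} = 0` at `V` ⇒ `t_{s′}(V) = 0`»).  This file RE-KEYS the chain to that one row:

§1  generic `θ`, hypothesis `hrstep` = the `rstep` row's own Π-type (instance-generic, exactly node00-def-T's field text): `…_of_rstep` twins of the identity, the
    step, the leaf, its law form, the `rOperation` reading, the a.e. identity of densities, the (S1ᵀ)-live step and induction; `rstep_of_provisos₁₃` (v1.0 ⟹ here).
§2  at node00-def-T's selector clause `hsel : θ.ppSel = ppSelLiveOfRecord … (EOfRecord₁₃ θ) …`: the same from `hrstep` (idempotency and «moved ⇒ dead» by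
    `…B16RLeafRecord13Live` §6); and ★ `rstep₁₃_of_liveSel_of_hasResiduals`: AT THE LIVE SELECTOR THE ROW `rstep` IS A THEOREM of K0b's `HasResidualsOfRecord`
    (`Node00.Record13` §4c `rstep₁₃_of_localBg_liveSel` over seat K0c's theorem `localBgMeasurable` — (H-U) is absolute — and the ζ-laws of the (3.16) factor of
    record); hence ★★ `rOpLeaf_VOfRecord₁₃_of_liveSel_of_hasResiduals` — N13's conjunct on the live line from `HasResidualsOfRecord`, admissibility and the three
    term-constant signs, NO PROVISO FIELD AT ALL — with its law form, `rOperation` reading, a.e. identity and Theorem 1 from (S1ᵀ)-at-`LiveSeq`.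
§3  at K0a's re-pin `θ.liveRepin₁₃` (`hsel` is `rfl`): ★★ `rOpLeaf_VOfRecord₁₃_liveRepin₁₃_of_hasResiduals (hres) (hθ) (hκ hE₀ hB₀)` and companions.
§4  at the witnesses carrying K0b's residuals — ★★★ `rOpLeaf_VOfRecord₁₃_theta13LiveOfRecord : ROpLeaf (VOfRecord₁₃ F N (theta13LiveOfRecord F N) p)` with ZERO
    hypotheses; at `theta13LiveOfFamily ε₀` (`0 < ε₀`), `theta13LiveOfFamily₂ ε₀ ε₂₉`, the all-numerics `theta13LiveOfNumerics n ε₂₉` (`n.Pos`, `0 < ε₂₉`, signs of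
    `n`), and ★★ at node00-def-K0a FILE 10a's [15]-keyed witness `theta13OfThm1 ε₀ ε₂₉ B₃ a₀ a₁` under its five admissibility signs — NO [15] fact, NO `bg`, NO
    numerics clause (and the same at FILE 11a's `L`-keyed twin `theta13OfThm1C`): the (R₁₃) slot of the K1‴ knit (`hR13` of dag-n24-c's Stage-13 modules, n12's
    `rRow`) is a THEOREM at every live witness, independent of row P11.

WHERE `bg` DOES ENTER (for the record, tree state at filing): `Provisos₁₃.bg` is read by exactly one theorem, node00-def-T's `norm_E_bg_le_stage13` ((2.27)(iv)
biting at the background of record — the Sect-2 ∕ (S1ᵀ) side, seat dag-n11-d's lane), and it enters the K1‴ binder only through `h` in `datumOfRecord₁₃ F N θ h`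
(whose tower reads `h.tstep` ∕ `h.rstep`).  HONEST SCOPE (unchanged): on the live line 𝐑 integrates out only terms of zero fibre mass; [B16] Theorem 1's
𝐑-construction is NOT exercised (its currency is `…B16RLeafRecord13Live` §7's general-selector socket); nothing of Bałaban is asserted; count-neutral.
-/

noncomputable section

open MeasureTheory
open scoped BigOperators Matrix.Norms.L2Operator

namespace Literature.MathematicalPhysics.QuantumFieldTheory.Balaban1983to89.B16RLeafRecord13LiveRstep

open T4Continuum T4DatumAssembly Node00 B14.Eq218Concrete DagBinding
open B16RLeafRecord11 B16RLeafRecord12 B16RLeafRecord12Live B16RLeafRecord12AtLive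
open B16RLeafRecord13Live B16RLeafRecord13AtLive

variable (F : T4Family) (N : ℕ) [NeZero N]

/-! ## §1  ROW-`rstep`-ONLY forms of the live-line chain (generic `θ`; hypothesis `hrstep` = node00-def-T's field `Provisos₁₃.rstep` as a stand-alone Π-type) -/

section RstepOnly

variable (θ : Stage13Params F N) (p : B12.RunParams)

variable {F N θ} in
/-- **v1.0's hypothesis implies this file's**: `Provisos₁₃` carries the row `rstep` (projection). [cite: Balaban1989LargeFieldI, (0.3) p.176 (bookkeeping)] -/
theorem rstep_of_provisos₁₃ (h : θ.Provisos₁₃ F N) :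
    ∀ (p : B12.RunParams) (k : ℕ) [DecidableEq (PBond (F.P p.K) (k + 1))], k < p.K →
      (towerRepOfRecord F N θ.ν θ.τ9 (slotsTOfRecord F N θ.ν θ.τ9 (EOfRecord₁₃ F N θ) (wOfRecord₉ F N θ.toStage9Params) θ.ppSel)
        θ.ppSel p (gOfRecord₁₃ F N θ p) (k + 1)).toRepData.ProvisosInt :=
  fun p k _ hk => h.rstep p k hk

/-- **AT A FIXED POINT `s′` ONTO WHICH ONLY DEAD SEQUENCES ARE SELECTED, `slot_{k+1}(s′) = slotT_{k+1}(s′)` A.E. ON THE `χ_{k+1}(s′)`-SUPPORT — FROM ROW `rstep`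
ALONE** (its third conjunct, the a.e. support clause; `…B16RLeafRecord13Live.slotsOfRecord₁₃_succ_ae_eq_slotsT_of_fix_of_dead` re-keyed).
[cite: Balaban1989LargeFieldI, (0.3) p.176, p.177 (i)–(ii); Balaban1988Convergent, (3.24)–(3.25) p.270] -/
theorem slotsOfRecord₁₃_succ_ae_eq_slotsT_of_fix_of_dead_of_rstep
    (hrstep : ∀ (p : B12.RunParams) (k : ℕ) [DecidableEq (PBond (F.P p.K) (k + 1))], k < p.K →
      (towerRepOfRecord F N θ.ν θ.τ9 (slotsTOfRecord F N θ.ν θ.τ9 (EOfRecord₁₃ F N θ) (wOfRecord₉ F N θ.toStage9Params) θ.ppSel)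
        θ.ppSel p (gOfRecord₁₃ F N θ p) (k + 1)).toRepData.ProvisosInt)
    (k : ℕ) (hk : k < p.K)
    (s' : SeqOfRecord F θ.ν θ.τ9.M (gOfRecord₁₃ F N θ p) p.K (k + 1))
    (hfix : θ.ppSel p (gOfRecord₁₃ F N θ p) (k + 1) s' = s')
    (hdead : ∀ a, θ.ppSel p (gOfRecord₁₃ F N θ p) (k + 1) a = s' → a ≠ s' →
      ∀ V, B15.BasicStep.fibreIntegral (fibOfSeq F θ.ν θ.τ9 p (gOfRecord₁₃ F N θ p) (k + 1) a)
        (rterm (sliceOfRecord F N θ.ν θ.τ9.M p (gOfRecord₁₃ F N θ p) (k + 1)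
          (slotsTOfRecord F N θ.ν θ.τ9 (EOfRecord₁₃ F N θ) (wOfRecord₉ F N θ.toStage9Params) θ.ppSel p (gOfRecord₁₃ F N θ p) (k + 1))) a) V = 0) :
    ∀ᵐ V ∂(fieldMeasure (F.P p.K) (k + 1) (SU N)),
      chiSeqOfRecord F N θ.ν θ.τ9.M (gOfRecord₁₃ F N θ p) p.K (k + 1) s' V ≠ 0 →
        slotsOfRecord F N θ.ν θ.τ9 (EOfRecord₁₃ F N θ) (wOfRecord₉ F N θ.toStage9Params) θ.ppSel p (gOfRecord₁₃ F N θ p) (k + 1) s' V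
          = slotsTOfRecord F N θ.ν θ.τ9 (EOfRecord₁₃ F N θ) (wOfRecord₉ F N θ.toStage9Params) θ.ppSel p (gOfRecord₁₃ F N θ p) (k + 1) s' V := by
  have HP := (hrstep p k hk).2.2 s'
  filter_upwards [HP] with V hV
  intro hχ
  rw [slotsOfRecord_succ]
  refine rstepSlotOfRecord_of_fix_of_dead θ.ν θ.τ9 θ.ppSel p _ (k + 1) _ s' hfix (fun a ha hne W => hdead a ha hne W) V ?_ hχ
  have H : B15.BasicStep.fibreIntegral (fibOfSeq F θ.ν θ.τ9 p (gOfRecord₁₃ F N θ p) (k + 1) s')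
      (rterm (repr218OfRecord F N θ.ν θ.τ9.M (slotsTOfRecord F N θ.ν θ.τ9 (EOfRecord₁₃ F N θ)
        (wOfRecord₉ F N θ.toStage9Params) θ.ppSel) p (gOfRecord₁₃ F N θ p) (k + 1))
        (θ.ppSel p (gOfRecord₁₃ F N θ p) (k + 1) s')) V = 0 →
      rterm (repr218OfRecord F N θ.ν θ.τ9.M (slotsTOfRecord F N θ.ν θ.τ9 (EOfRecord₁₃ F N θ)
        (wOfRecord₉ F N θ.toStage9Params) θ.ppSel) p (gOfRecord₁₃ F N θ p) (k + 1)) s' V = 0 := hV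
  rw [hfix] at H
  intro h0
  apply H
  convert h0 using 2
  rfl

/-- **`TLaw₁₃ k → SLaw₁₃ (k+1)` ON THE DEAD-MOVING BRANCH FROM ROW `rstep` ALONE** (+ admissibility for `0 ≤ β`, the displayed `0 ≤ κ, E₀, B₀`, `0 ≤ g_{k+1}` free):
`…B16RLeafRecord13Live.sLaw₁₃_succ_of_tLaw₁₃_of_idem_of_dead` re-keyed. [cite: Balaban1988Convergent, §2 p.262, Thm 2 p.263, (3.24)–(3.25) p.270; Balaban1989LargeFieldI, (0.3) p.176, p.177 (i)–(ii)] -/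
theorem sLaw₁₃_succ_of_tLaw₁₃_of_idem_of_dead_of_rstep
    (hrstep : ∀ (p : B12.RunParams) (k : ℕ) [DecidableEq (PBond (F.P p.K) (k + 1))], k < p.K →
      (towerRepOfRecord F N θ.ν θ.τ9 (slotsTOfRecord F N θ.ν θ.τ9 (EOfRecord₁₃ F N θ) (wOfRecord₉ F N θ.toStage9Params) θ.ppSel)
        θ.ppSel p (gOfRecord₁₃ F N θ p) (k + 1)).toRepData.ProvisosInt)
    (hθ : θ.Admissible F N) (hκ : 0 ≤ θ.s2.lf.κ) (hE₀ : 0 ≤ θ.s2.lf.E₀) (hB₀ : 0 ≤ θ.s2.lf.B₀) (k : ℕ) (hk : k < p.K)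
    (hidem : ∀ a, θ.ppSel p (gOfRecord₁₃ F N θ p) (k + 1) (θ.ppSel p (gOfRecord₁₃ F N θ p) (k + 1) a) = θ.ppSel p (gOfRecord₁₃ F N θ p) (k + 1) a)
    (hdead : ∀ a, θ.ppSel p (gOfRecord₁₃ F N θ p) (k + 1) a ≠ a →
      ∀ V, B15.BasicStep.fibreIntegral (fibOfSeq F θ.ν θ.τ9 p (gOfRecord₁₃ F N θ p) (k + 1) a)
        (rterm (sliceOfRecord F N θ.ν θ.τ9.M p (gOfRecord₁₃ F N θ p) (k + 1)
          (slotsTOfRecord F N θ.ν θ.τ9 (EOfRecord₁₃ F N θ) (wOfRecord₉ F N θ.toStage9Params) θ.ppSel p (gOfRecord₁₃ F N θ p) (k + 1))) a) V = 0)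
    (hT : TLaw₁₃ F N θ p k) : SLaw₁₃ F N θ p (k + 1) := by
  rw [sLaw₁₃_iff]
  have hA := ((tLaw₁₃_iff F N θ p k).mp hT).toFormAEZ_succ hθ.toStage12.pos.2.1 hκ hE₀ hB₀ (gOfRecord₁₃_succ_nonneg F N θ p k)
  obtain ⟨t, Ek, hu, hs⟩ := hA
  refine ⟨t, Ek, hu, fun s => ⟨(hs s).1, ?_⟩⟩
  by_cases hmem : s ∈ Set.range (θ.ppSel p (gOfRecord₁₃ F N θ p) (k + 1))
  · obtain ⟨b, hb⟩ := hmem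
    have hfix : θ.ppSel p (gOfRecord₁₃ F N θ p) (k + 1) s = s := by rw [← hb]; exact hidem b
    rcases (hs s).2 with h0 | hid
    · exact Or.inl (slotsOfRecord₁₃_succ_eq_zero_of_slotsT_eq_zero F N θ p k s h0)
    · refine Or.inr ?_
      filter_upwards [hid, slotsOfRecord₁₃_succ_ae_eq_slotsT_of_fix_of_dead_of_rstep F N θ p hrstep k hk s hfix
        (fun a ha hne => hdead a fun heq => hne (heq.symm.trans ha))] with V hV hVid hχ
      rw [hVid hχ]
      exact hV hχ
  · exact Or.inl (slotsOfRecord₁₃_succ_eq_zero_of_not_mem_range F N θ p k s hmem)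

/-- **★ THE 𝐑-LEAF OF RECORD AT STAGE 13 ON THE DEAD-MOVING BRANCH FROM ROW `rstep` ALONE** (+ admissibility and the three term-constant signs): `ROpLeaf (VOfRecord₁₃ θ p)`
— `…B16RLeafRecord13Live.rOpLeaf_VOfRecord₁₃_of_idem_of_dead` re-keyed; no `bg`, no ζ-law, no measurability row is read.
[cite: Balaban1988Convergent, p.244, Thm 2 p.263; Balaban1989LargeFieldI, (0.3) p.176, p.177 (i)–(ii); Balaban1989LargeFieldII, Thm 1 p.355 (not exercised)] -/
theorem rOpLeaf_VOfRecord₁₃_of_idem_of_dead_of_rstep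
    (hrstep : ∀ (p : B12.RunParams) (k : ℕ) [DecidableEq (PBond (F.P p.K) (k + 1))], k < p.K →
      (towerRepOfRecord F N θ.ν θ.τ9 (slotsTOfRecord F N θ.ν θ.τ9 (EOfRecord₁₃ F N θ) (wOfRecord₉ F N θ.toStage9Params) θ.ppSel)
        θ.ppSel p (gOfRecord₁₃ F N θ p) (k + 1)).toRepData.ProvisosInt)
    (hθ : θ.Admissible F N) (hκ : 0 ≤ θ.s2.lf.κ) (hE₀ : 0 ≤ θ.s2.lf.E₀) (hB₀ : 0 ≤ θ.s2.lf.B₀)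
    (hidem : ∀ k, k < p.K → ∀ a, θ.ppSel p (gOfRecord₁₃ F N θ p) (k + 1)
      (θ.ppSel p (gOfRecord₁₃ F N θ p) (k + 1) a) = θ.ppSel p (gOfRecord₁₃ F N θ p) (k + 1) a)
    (hdead : ∀ k, k < p.K → ∀ a, θ.ppSel p (gOfRecord₁₃ F N θ p) (k + 1) a ≠ a →
      ∀ V, B15.BasicStep.fibreIntegral (fibOfSeq F θ.ν θ.τ9 p (gOfRecord₁₃ F N θ p) (k + 1) a)
        (rterm (sliceOfRecord F N θ.ν θ.τ9.M p (gOfRecord₁₃ F N θ p) (k + 1)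
          (slotsTOfRecord F N θ.ν θ.τ9 (EOfRecord₁₃ F N θ) (wOfRecord₉ F N θ.toStage9Params) θ.ppSel p (gOfRecord₁₃ F N θ p) (k + 1))) a) V = 0) :
    ROpLeaf (VOfRecord₁₃ F N θ p) := by
  rw [rOpLeaf_VOfRecord₁₃_iff]
  intro k hk hT
  exact sLaw₁₃_succ_of_tLaw₁₃_of_idem_of_dead_of_rstep F N θ p hrstep hθ hκ hE₀ hB₀ k hk (hidem k hk) (hdead k hk) hT

/-- **The leaf IN LAW FORM from row `rstep` alone** — the (R₁₃) slot `∀ k < K, TLaw₁₃ θ p k → SLaw₁₃ θ p (k+1)`, dead-moving branch.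
[cite: Balaban1988Convergent, p.244 (bookkeeping); Balaban1989LargeFieldII, Thm 1 p.355 (not exercised)] -/
theorem laws₁₃_of_idem_of_dead_of_rstep
    (hrstep : ∀ (p : B12.RunParams) (k : ℕ) [DecidableEq (PBond (F.P p.K) (k + 1))], k < p.K →
      (towerRepOfRecord F N θ.ν θ.τ9 (slotsTOfRecord F N θ.ν θ.τ9 (EOfRecord₁₃ F N θ) (wOfRecord₉ F N θ.toStage9Params) θ.ppSel)
        θ.ppSel p (gOfRecord₁₃ F N θ p) (k + 1)).toRepData.ProvisosInt)
    (hθ : θ.Admissible F N) (hκ : 0 ≤ θ.s2.lf.κ) (hE₀ : 0 ≤ θ.s2.lf.E₀) (hB₀ : 0 ≤ θ.s2.lf.B₀)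
    (hidem : ∀ k, k < p.K → ∀ a, θ.ppSel p (gOfRecord₁₃ F N θ p) (k + 1)
      (θ.ppSel p (gOfRecord₁₃ F N θ p) (k + 1) a) = θ.ppSel p (gOfRecord₁₃ F N θ p) (k + 1) a)
    (hdead : ∀ k, k < p.K → ∀ a, θ.ppSel p (gOfRecord₁₃ F N θ p) (k + 1) a ≠ a →
      ∀ V, B15.BasicStep.fibreIntegral (fibOfSeq F θ.ν θ.τ9 p (gOfRecord₁₃ F N θ p) (k + 1) a)
        (rterm (sliceOfRecord F N θ.ν θ.τ9.M p (gOfRecord₁₃ F N θ p) (k + 1)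
          (slotsTOfRecord F N θ.ν θ.τ9 (EOfRecord₁₃ F N θ) (wOfRecord₉ F N θ.toStage9Params) θ.ppSel p (gOfRecord₁₃ F N θ p) (k + 1))) a) V = 0) :
    ∀ k, k < p.K → TLaw₁₃ F N θ p k → SLaw₁₃ F N θ p (k + 1) :=
  (rOpLeaf_VOfRecord₁₃_iff F N θ p).mp (rOpLeaf_VOfRecord₁₃_of_idem_of_dead_of_rstep F N θ p hrstep hθ hκ hE₀ hB₀ hidem hdead)

/-- **The run's `rOperation` leaf reads TRUE at any world whose `up`-slots are NODE 00's C-binding over the Stage-13 view, dead-moving branch, from row `rstep` alone.**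
[cite: Balaban1988Convergent, p.244; Balaban1989LargeFieldII, Thm 1 p.355 (bookkeeping at the record)] -/
theorem rOperation_leavesP_of_idem_of_dead₁₃_of_rstep (w : WorldP) (hup : w.up p = upOfRecord₅C F N (θ.toStage5₁₃ F N) p)
    (hrstep : ∀ (p : B12.RunParams) (k : ℕ) [DecidableEq (PBond (F.P p.K) (k + 1))], k < p.K →
      (towerRepOfRecord F N θ.ν θ.τ9 (slotsTOfRecord F N θ.ν θ.τ9 (EOfRecord₁₃ F N θ) (wOfRecord₉ F N θ.toStage9Params) θ.ppSel)
        θ.ppSel p (gOfRecord₁₃ F N θ p) (k + 1)).toRepData.ProvisosInt)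
    (hθ : θ.Admissible F N) (hκ : 0 ≤ θ.s2.lf.κ) (hE₀ : 0 ≤ θ.s2.lf.E₀) (hB₀ : 0 ≤ θ.s2.lf.B₀)
    (hidem : ∀ k, k < p.K → ∀ a, θ.ppSel p (gOfRecord₁₃ F N θ p) (k + 1)
      (θ.ppSel p (gOfRecord₁₃ F N θ p) (k + 1) a) = θ.ppSel p (gOfRecord₁₃ F N θ p) (k + 1) a)
    (hdead : ∀ k, k < p.K → ∀ a, θ.ppSel p (gOfRecord₁₃ F N θ p) (k + 1) a ≠ a →
      ∀ V, B15.BasicStep.fibreIntegral (fibOfSeq F θ.ν θ.τ9 p (gOfRecord₁₃ F N θ p) (k + 1) a)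
        (rterm (sliceOfRecord F N θ.ν θ.τ9.M p (gOfRecord₁₃ F N θ p) (k + 1)
          (slotsTOfRecord F N θ.ν θ.τ9 (EOfRecord₁₃ F N θ) (wOfRecord₉ F N θ.toStage9Params) θ.ppSel p (gOfRecord₁₃ F N θ p) (k + 1))) a) V = 0) :
    (leavesP w p).rOperation := by
  show (w.up p).rOperation
  rw [hup, rOperation_upOfRecord₅C_stage13_iff]
  exact laws₁₃_of_idem_of_dead_of_rstep F N θ p hrstep hθ hκ hE₀ hB₀ hidem hdead

/-- **★ `ρ_{k+1} = 𝐓ρ_k` ALMOST EVERYWHERE ON THE DEAD-MOVING BRANCH FROM ROW `rstep` ALONE** (`k < K`; all three conjuncts are read: integrability and the a.e.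
sign of every piece for def-R's `ae_eq_zero_of_self_or_fibreIntegral_eq_zero` at a moved — hence dead — sequence, the support clause at a fixed point):
`…B16RLeafRecord13Live.densOfRecord₁₃_succ_ae_eq_tdens_of_idem_of_dead` re-keyed. [cite: Balaban1989LargeFieldI, (0.2)–(0.4) p.176, p.177 (i)–(ii); Balaban1988Convergent, (2.18) p.257, (3.24)–(3.25) p.270; Balaban1989LargeFieldII, Thm 1 p.355 (not exercised)] -/
theorem densOfRecord₁₃_succ_ae_eq_tdens_of_idem_of_dead_of_rstep
    (hrstep : ∀ (p : B12.RunParams) (k : ℕ) [DecidableEq (PBond (F.P p.K) (k + 1))], k < p.K →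
      (towerRepOfRecord F N θ.ν θ.τ9 (slotsTOfRecord F N θ.ν θ.τ9 (EOfRecord₁₃ F N θ) (wOfRecord₉ F N θ.toStage9Params) θ.ppSel)
        θ.ppSel p (gOfRecord₁₃ F N θ p) (k + 1)).toRepData.ProvisosInt)
    (k : ℕ) (hk : k < p.K)
    (hidem : ∀ a, θ.ppSel p (gOfRecord₁₃ F N θ p) (k + 1) (θ.ppSel p (gOfRecord₁₃ F N θ p) (k + 1) a) = θ.ppSel p (gOfRecord₁₃ F N θ p) (k + 1) a)
    (hdead : ∀ a, θ.ppSel p (gOfRecord₁₃ F N θ p) (k + 1) a ≠ a →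
      ∀ V, B15.BasicStep.fibreIntegral (fibOfSeq F θ.ν θ.τ9 p (gOfRecord₁₃ F N θ p) (k + 1) a)
        (rterm (sliceOfRecord F N θ.ν θ.τ9.M p (gOfRecord₁₃ F N θ p) (k + 1)
          (slotsTOfRecord F N θ.ν θ.τ9 (EOfRecord₁₃ F N θ) (wOfRecord₉ F N θ.toStage9Params) θ.ppSel p (gOfRecord₁₃ F N θ p) (k + 1))) a) V = 0) :
    densOfRecord₁₃ F N θ p (k + 1) =ᵐ[fieldMeasure (F.P p.K) (k + 1) (SU N)] tdensOfRecord₁₃ F N θ p k := by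
  have HP := hrstep p k hk
  have hs : ∀ s, ∀ᵐ V ∂(fieldMeasure (F.P p.K) (k + 1) (SU N)),
      chiSeqOfRecord F N θ.ν θ.τ9.M (gOfRecord₁₃ F N θ p) p.K (k + 1) s V *
          slotsOfRecord F N θ.ν θ.τ9 (EOfRecord₁₃ F N θ) (wOfRecord₉ F N θ.toStage9Params) θ.ppSel p (gOfRecord₁₃ F N θ p) (k + 1) s V
        = chiSeqOfRecord F N θ.ν θ.τ9.M (gOfRecord₁₃ F N θ p) p.K (k + 1) s V *
          slotsTOfRecord F N θ.ν θ.τ9 (EOfRecord₁₃ F N θ) (wOfRecord₉ F N θ.toStage9Params) θ.ppSel p (gOfRecord₁₃ F N θ p) (k + 1) s V := by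
    intro s
    by_cases hfix : θ.ppSel p (gOfRecord₁₃ F N θ p) (k + 1) s = s
    · filter_upwards [slotsOfRecord₁₃_succ_ae_eq_slotsT_of_fix_of_dead_of_rstep F N θ p hrstep k hk s hfix
        (fun a ha hne => hdead a fun heq => hne (heq.symm.trans ha))] with V hV
      by_cases hχ : chiSeqOfRecord F N θ.ν θ.τ9.M (gOfRecord₁₃ F N θ p) p.K (k + 1) s V = 0
      · rw [hχ, zero_mul, zero_mul]
      · rw [hV hχ]
    · have hnr : s ∉ Set.range (θ.ppSel p (gOfRecord₁₃ F N θ p) (k + 1)) := not_mem_range_of_idem_of_ne hidem hfix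
      have hz := slotsOfRecord₁₃_succ_eq_zero_of_not_mem_range F N θ p k s hnr
      have hi : Integrable (fun V => chiSeqOfRecord F N θ.ν θ.τ9.M (gOfRecord₁₃ F N θ p) p.K (k + 1) s V *
          slotsTOfRecord F N θ.ν θ.τ9 (EOfRecord₁₃ F N θ) (wOfRecord₉ F N θ.toStage9Params) θ.ppSel p (gOfRecord₁₃ F N θ p) (k + 1) s V)
          (fieldMeasure (F.P p.K) (k + 1) (SU N)) := HP.1 s
      have h0 : ∀ᵐ V ∂(fieldMeasure (F.P p.K) (k + 1) (SU N)), 0 ≤ chiSeqOfRecord F N θ.ν θ.τ9.M (gOfRecord₁₃ F N θ p) p.K (k + 1) s V *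
          slotsTOfRecord F N θ.ν θ.τ9 (EOfRecord₁₃ F N θ) (wOfRecord₉ F N θ.toStage9Params) θ.ppSel p (gOfRecord₁₃ F N θ p) (k + 1) s V := HP.2.1 s
      have hae := B15.BasicStep.ae_eq_zero_of_self_or_fibreIntegral_eq_zero
        (fibOfSeq F θ.ν θ.τ9 p (gOfRecord₁₃ F N θ p) (k + 1) s) hi h0 (fun V => Or.inr (by
          have H := hdead s hfix V
          convert H using 2
          rfl))
      filter_upwards [hae] with V hV
      have hV' : chiSeqOfRecord F N θ.ν θ.τ9.M (gOfRecord₁₃ F N θ p) p.K (k + 1) s V *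
          slotsTOfRecord F N θ.ν θ.τ9 (EOfRecord₁₃ F N θ) (wOfRecord₉ F N θ.toStage9Params) θ.ppSel p (gOfRecord₁₃ F N θ p) (k + 1) s V = 0 := hV
      rw [hz, Pi.zero_apply, mul_zero, hV']
  have hall := ae_all_iff.2 hs
  filter_upwards [hall] with V hV
  exact Finset.sum_congr rfl fun s _ => hV s

/-- **★ `TLaw` AT THE LIVE SEQUENCES ONLY ⇒ `SLaw₁₃ (k+1)`, dead-moving branch, FROM ROW `rstep` ALONE** (N11's per-level share of Theorem 1 on this branch):
`…B16RLeafRecord13Live.sLaw₁₃_succ_of_tLawLive_of_idem_of_dead` re-keyed. [cite: Balaban1988Convergent, §2 p.262, Thm 2 p.263, (3.24)–(3.25) p.270; Balaban1989LargeFieldI, (0.3) p.176, p.177 (i)–(ii)] -/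
theorem sLaw₁₃_succ_of_tLawLive_of_idem_of_dead_of_rstep
    (hrstep : ∀ (p : B12.RunParams) (k : ℕ) [DecidableEq (PBond (F.P p.K) (k + 1))], k < p.K →
      (towerRepOfRecord F N θ.ν θ.τ9 (slotsTOfRecord F N θ.ν θ.τ9 (EOfRecord₁₃ F N θ) (wOfRecord₉ F N θ.toStage9Params) θ.ppSel)
        θ.ppSel p (gOfRecord₁₃ F N θ p) (k + 1)).toRepData.ProvisosInt)
    (hθ : θ.Admissible F N) (hκ : 0 ≤ θ.s2.lf.κ) (hE₀ : 0 ≤ θ.s2.lf.E₀) (hB₀ : 0 ≤ θ.s2.lf.B₀) (k : ℕ) (hk : k < p.K)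
    (hidem : ∀ a, θ.ppSel p (gOfRecord₁₃ F N θ p) (k + 1) (θ.ppSel p (gOfRecord₁₃ F N θ p) (k + 1) a) = θ.ppSel p (gOfRecord₁₃ F N θ p) (k + 1) a)
    (hdead : ∀ a, θ.ppSel p (gOfRecord₁₃ F N θ p) (k + 1) a ≠ a →
      ∀ V, B15.BasicStep.fibreIntegral (fibOfSeq F θ.ν θ.τ9 p (gOfRecord₁₃ F N θ p) (k + 1) a)
        (rterm (sliceOfRecord F N θ.ν θ.τ9.M p (gOfRecord₁₃ F N θ p) (k + 1)
          (slotsTOfRecord F N θ.ν θ.τ9 (EOfRecord₁₃ F N θ) (wOfRecord₉ F N θ.toStage9Params) θ.ppSel p (gOfRecord₁₃ F N θ p) (k + 1))) a) V = 0)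
    (hT : ∃ (t : SeqOfRecord F θ.ν θ.τ9.M (gOfRecord₁₃ F N θ p) p.K (k + 1) → Sect2.TermValues (F.P p.K) (MatA N) (FluctV N) θ.τ9.M)
      (Ek : SeqOfRecord F θ.ν θ.τ9.M (gOfRecord₁₃ F N θ p) p.K (k + 1) → ℝ), Sect2.UniversalE t ∧
      ∀ s, Sect2.LawsT (sect2TowerOfRecord F N (FluctV N) p.K (settingOfRecord₁₃ F N θ p) (θ.Rz p.K) s (t s)) (settingOfRecord₁₃ F N θ p).lf
          (settingOfRecord₁₃ F N θ p).βc k ∧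
        ((∃ V, B15.BasicStep.fibreIntegral (fibOfSeq F θ.ν θ.τ9 p (gOfRecord₁₃ F N θ p) (k + 1) s)
        (rterm (sliceOfRecord F N θ.ν θ.τ9.M p (gOfRecord₁₃ F N θ p) (k + 1)
          (slotsTOfRecord F N θ.ν θ.τ9 (EOfRecord₁₃ F N θ) (wOfRecord₉ F N θ.toStage9Params) θ.ppSel p (gOfRecord₁₃ F N θ p) (k + 1))) s) V ≠ 0) →
          (slotsTOfRecord F N θ.ν θ.τ9 (EOfRecord₁₃ F N θ) (wOfRecord₉ F N θ.toStage9Params) θ.ppSel p (gOfRecord₁₃ F N θ p) (k + 1) s = 0 ∨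
            ∀ᵐ V ∂(fieldMeasure (F.P p.K) (k + 1) (SU N)), chiSeqOfRecord F N θ.ν θ.τ9.M (gOfRecord₁₃ F N θ p) p.K (k + 1) s V ≠ 0 →
              slotsTOfRecord F N θ.ν θ.τ9 (EOfRecord₁₃ F N θ) (wOfRecord₉ F N θ.toStage9Params) θ.ppSel p (gOfRecord₁₃ F N θ p) (k + 1) s V
                = sect2Slot F N (FluctV N) p.K (settingOfRecord₁₃ F N θ p) (θ.Rz p.K) (WtOfRecord₁₃ F N θ p) s (t s) (Ek s)
                    (UbgOfRecord₁₃ F N θ p (k + 1) s) V))) :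
    SLaw₁₃ F N θ p (k + 1) := by
  rw [sLaw₁₃_iff]
  obtain ⟨t, Ek, hu, hs⟩ := hT
  refine ⟨t, Ek, hu, fun s => ⟨(hs s).1.toRT_succ hθ.toStage12.pos.2.1 hκ hE₀ hB₀ (gOfRecord₁₃_succ_nonneg F N θ p k), ?_⟩⟩
  by_cases hsd : ∀ V, B15.BasicStep.fibreIntegral (fibOfSeq F θ.ν θ.τ9 p (gOfRecord₁₃ F N θ p) (k + 1) s)
        (rterm (sliceOfRecord F N θ.ν θ.τ9.M p (gOfRecord₁₃ F N θ p) (k + 1)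
          (slotsTOfRecord F N θ.ν θ.τ9 (EOfRecord₁₃ F N θ) (wOfRecord₉ F N θ.toStage9Params) θ.ppSel p (gOfRecord₁₃ F N θ p) (k + 1))) s) V = 0
  · exact Or.inl (slotsOfRecord₁₃_succ_eq_zero_of_dead F N θ p k hidem hdead s hsd)
  · have hlive : ∃ V, B15.BasicStep.fibreIntegral (fibOfSeq F θ.ν θ.τ9 p (gOfRecord₁₃ F N θ p) (k + 1) s)
        (rterm (sliceOfRecord F N θ.ν θ.τ9.M p (gOfRecord₁₃ F N θ p) (k + 1)
          (slotsTOfRecord F N θ.ν θ.τ9 (EOfRecord₁₃ F N θ) (wOfRecord₉ F N θ.toStage9Params) θ.ppSel p (gOfRecord₁₃ F N θ p) (k + 1))) s) V ≠ 0 := by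
      by_contra hnone
      exact hsd fun V => by_contra fun hV => hnone ⟨V, hV⟩
    have hfix : θ.ppSel p (gOfRecord₁₃ F N θ p) (k + 1) s = s := by
      by_contra hne
      exact hsd (hdead s hne)
    rcases (hs s).2 hlive with h0 | hid
    · exact Or.inl (slotsOfRecord₁₃_succ_eq_zero_of_slotsT_eq_zero F N θ p k s h0)
    · refine Or.inr ?_
      filter_upwards [hid, slotsOfRecord₁₃_succ_ae_eq_slotsT_of_fix_of_dead_of_rstep F N θ p hrstep k hk s hfix
        (fun a ha hne => hdead a fun heq => hne (heq.symm.trans ha))] with V hV hVid hχ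
      rw [hVid hχ]
      exact hV hχ

/-- **★ THEOREM 1 [III] AT THE STAGE-13 OBJECTS OF RECORD FROM (S1ᵀ) AT THE LIVE SEQUENCES ONLY, dead-moving branch, FROM ROW `rstep` ALONE**: induction from
node00-def-T's start `sLaw₁₃_zero`. [cite: Balaban1988Convergent, Thm 1 p.262; Theorem p.245; p.244; Balaban1989LargeFieldI, (0.3) p.176, p.177 (i)–(ii)] -/
theorem sLaw₁₃_all_of_thmP245Live_of_idem_of_dead_of_rstep
    (hrstep : ∀ (p : B12.RunParams) (k : ℕ) [DecidableEq (PBond (F.P p.K) (k + 1))], k < p.K →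
      (towerRepOfRecord F N θ.ν θ.τ9 (slotsTOfRecord F N θ.ν θ.τ9 (EOfRecord₁₃ F N θ) (wOfRecord₉ F N θ.toStage9Params) θ.ppSel)
        θ.ppSel p (gOfRecord₁₃ F N θ p) (k + 1)).toRepData.ProvisosInt)
    (hθ : θ.Admissible F N) (hκ : 0 ≤ θ.s2.lf.κ) (hE₀ : 0 ≤ θ.s2.lf.E₀) (hB₀ : 0 ≤ θ.s2.lf.B₀)
    (hidem : ∀ k, k < p.K → ∀ a, θ.ppSel p (gOfRecord₁₃ F N θ p) (k + 1)
      (θ.ppSel p (gOfRecord₁₃ F N θ p) (k + 1) a) = θ.ppSel p (gOfRecord₁₃ F N θ p) (k + 1) a)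
    (hdead : ∀ k, k < p.K → ∀ a, θ.ppSel p (gOfRecord₁₃ F N θ p) (k + 1) a ≠ a →
      ∀ V, B15.BasicStep.fibreIntegral (fibOfSeq F θ.ν θ.τ9 p (gOfRecord₁₃ F N θ p) (k + 1) a)
        (rterm (sliceOfRecord F N θ.ν θ.τ9.M p (gOfRecord₁₃ F N θ p) (k + 1)
          (slotsTOfRecord F N θ.ν θ.τ9 (EOfRecord₁₃ F N θ) (wOfRecord₉ F N θ.toStage9Params) θ.ppSel p (gOfRecord₁₃ F N θ p) (k + 1))) a) V = 0)
    (hT : ∀ k, k < p.K → SLaw₁₃ F N θ p k →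
      ∃ (t : SeqOfRecord F θ.ν θ.τ9.M (gOfRecord₁₃ F N θ p) p.K (k + 1) → Sect2.TermValues (F.P p.K) (MatA N) (FluctV N) θ.τ9.M)
      (Ek : SeqOfRecord F θ.ν θ.τ9.M (gOfRecord₁₃ F N θ p) p.K (k + 1) → ℝ), Sect2.UniversalE t ∧
      ∀ s, Sect2.LawsT (sect2TowerOfRecord F N (FluctV N) p.K (settingOfRecord₁₃ F N θ p) (θ.Rz p.K) s (t s)) (settingOfRecord₁₃ F N θ p).lf
          (settingOfRecord₁₃ F N θ p).βc k ∧
        ((∃ V, B15.BasicStep.fibreIntegral (fibOfSeq F θ.ν θ.τ9 p (gOfRecord₁₃ F N θ p) (k + 1) s)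
        (rterm (sliceOfRecord F N θ.ν θ.τ9.M p (gOfRecord₁₃ F N θ p) (k + 1)
          (slotsTOfRecord F N θ.ν θ.τ9 (EOfRecord₁₃ F N θ) (wOfRecord₉ F N θ.toStage9Params) θ.ppSel p (gOfRecord₁₃ F N θ p) (k + 1))) s) V ≠ 0) →
          (slotsTOfRecord F N θ.ν θ.τ9 (EOfRecord₁₃ F N θ) (wOfRecord₉ F N θ.toStage9Params) θ.ppSel p (gOfRecord₁₃ F N θ p) (k + 1) s = 0 ∨
            ∀ᵐ V ∂(fieldMeasure (F.P p.K) (k + 1) (SU N)), chiSeqOfRecord F N θ.ν θ.τ9.M (gOfRecord₁₃ F N θ p) p.K (k + 1) s V ≠ 0 →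
              slotsTOfRecord F N θ.ν θ.τ9 (EOfRecord₁₃ F N θ) (wOfRecord₉ F N θ.toStage9Params) θ.ppSel p (gOfRecord₁₃ F N θ p) (k + 1) s V
                = sect2Slot F N (FluctV N) p.K (settingOfRecord₁₃ F N θ p) (θ.Rz p.K) (WtOfRecord₁₃ F N θ p) s (t s) (Ek s)
                    (UbgOfRecord₁₃ F N θ p (k + 1) s) V))) :
    ∀ k, k ≤ p.K → SLaw₁₃ F N θ p k := by
  intro k
  induction k with
  | zero => exact fun _ => sLaw₁₃_zero F N θ p
  | succ n ih =>
    intro hk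
    exact sLaw₁₃_succ_of_tLawLive_of_idem_of_dead_of_rstep F N θ p hrstep hθ hκ hE₀ hB₀ n (Nat.lt_of_succ_le hk) (hidem n (Nat.lt_of_succ_le hk))
      (hdead n (Nat.lt_of_succ_le hk)) (hT n (Nat.lt_of_succ_le hk) (ih (Nat.le_of_succ_le hk)))

/-- **THEOREM 1 [III] from the FULL (S1ᵀ), dead-moving branch, from row `rstep` alone** (law reading `SLaw₁₃ k → TLaw₁₃ k`; the 𝐑-slot is this file's theorem).
[cite: Balaban1988Convergent, Thm 1 p.262; Theorem p.245; p.244] -/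
theorem sLaw₁₃_all_of_thmP245_of_idem_of_dead_of_rstep
    (hrstep : ∀ (p : B12.RunParams) (k : ℕ) [DecidableEq (PBond (F.P p.K) (k + 1))], k < p.K →
      (towerRepOfRecord F N θ.ν θ.τ9 (slotsTOfRecord F N θ.ν θ.τ9 (EOfRecord₁₃ F N θ) (wOfRecord₉ F N θ.toStage9Params) θ.ppSel)
        θ.ppSel p (gOfRecord₁₃ F N θ p) (k + 1)).toRepData.ProvisosInt)
    (hθ : θ.Admissible F N) (hκ : 0 ≤ θ.s2.lf.κ) (hE₀ : 0 ≤ θ.s2.lf.E₀) (hB₀ : 0 ≤ θ.s2.lf.B₀)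
    (hidem : ∀ k, k < p.K → ∀ a, θ.ppSel p (gOfRecord₁₃ F N θ p) (k + 1)
      (θ.ppSel p (gOfRecord₁₃ F N θ p) (k + 1) a) = θ.ppSel p (gOfRecord₁₃ F N θ p) (k + 1) a)
    (hdead : ∀ k, k < p.K → ∀ a, θ.ppSel p (gOfRecord₁₃ F N θ p) (k + 1) a ≠ a →
      ∀ V, B15.BasicStep.fibreIntegral (fibOfSeq F θ.ν θ.τ9 p (gOfRecord₁₃ F N θ p) (k + 1) a)
        (rterm (sliceOfRecord F N θ.ν θ.τ9.M p (gOfRecord₁₃ F N θ p) (k + 1)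
          (slotsTOfRecord F N θ.ν θ.τ9 (EOfRecord₁₃ F N θ) (wOfRecord₉ F N θ.toStage9Params) θ.ppSel p (gOfRecord₁₃ F N θ p) (k + 1))) a) V = 0)
    (hT : ∀ k, k < p.K → SLaw₁₃ F N θ p k → TLaw₁₃ F N θ p k) :
    ∀ k, k ≤ p.K → SLaw₁₃ F N θ p k :=
  sLaw₁₃_all_of_laws F N θ p (laws₁₃_of_idem_of_dead_of_rstep F N θ p hrstep hθ hκ hE₀ hB₀ hidem hdead) hT

end RstepOnly

/-! ## §2  AT node00-def-T's SELECTOR CLAUSE `hsel`: the chain from row `rstep` alone; and the row `rstep` ITSELF from K0b's `HasResidualsOfRecord` alone -/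

section LiveSel

variable (θ : Stage13Params F N) (p : B12.RunParams)

/-- **★ THE 𝐑-LEAF OF RECORD AT THE LIVE SELECTOR FROM ROW `rstep`, ADMISSIBILITY AND THE TERM-CONSTANT SIGNS ALONE.**
[cite: Balaban1988Convergent, p.244, Thm 2 p.263; Balaban1989LargeFieldI, (0.3) p.176, p.177 (i)–(ii); Balaban1989LargeFieldII, Thm 1 p.355 (not exercised)] -/
theorem rOpLeaf_VOfRecord₁₃_of_liveSel_of_rstep
    (hrstep : ∀ (p : B12.RunParams) (k : ℕ) [DecidableEq (PBond (F.P p.K) (k + 1))], k < p.K →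
      (towerRepOfRecord F N θ.ν θ.τ9 (slotsTOfRecord F N θ.ν θ.τ9 (EOfRecord₁₃ F N θ) (wOfRecord₉ F N θ.toStage9Params) θ.ppSel)
        θ.ppSel p (gOfRecord₁₃ F N θ p) (k + 1)).toRepData.ProvisosInt)
    (hθ : θ.Admissible F N) (hκ : 0 ≤ θ.s2.lf.κ) (hE₀ : 0 ≤ θ.s2.lf.E₀) (hB₀ : 0 ≤ θ.s2.lf.B₀)
    (hsel : θ.ppSel = ppSelLiveOfRecord F N θ.ν θ.τ9 (EOfRecord₁₃ F N θ) (wOfRecord₉ F N θ.toStage9Params)) :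
    ROpLeaf (VOfRecord₁₃ F N θ p) :=
  rOpLeaf_VOfRecord₁₃_of_idem_of_dead_of_rstep F N θ p hrstep hθ hκ hE₀ hB₀ (fun k _ => ppSel_succ_idem_of_liveSel F N θ hsel p k)
    (fun k _ a hne V => dead_of_ppSel_succ_ne_of_liveSel F N θ hsel p k a hne V)

/-- **The leaf in law form at the live selector from row `rstep` alone** (the (R₁₃) slot `hR13` of dag-n24-c's Stage-13 knit ∕ n12's `rRow`).
[cite: Balaban1988Convergent, p.244 (bookkeeping); Balaban1989LargeFieldII, Thm 1 p.355 (not exercised)] -/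
theorem laws₁₃_of_liveSel_of_rstep
    (hrstep : ∀ (p : B12.RunParams) (k : ℕ) [DecidableEq (PBond (F.P p.K) (k + 1))], k < p.K →
      (towerRepOfRecord F N θ.ν θ.τ9 (slotsTOfRecord F N θ.ν θ.τ9 (EOfRecord₁₃ F N θ) (wOfRecord₉ F N θ.toStage9Params) θ.ppSel)
        θ.ppSel p (gOfRecord₁₃ F N θ p) (k + 1)).toRepData.ProvisosInt)
    (hθ : θ.Admissible F N) (hκ : 0 ≤ θ.s2.lf.κ) (hE₀ : 0 ≤ θ.s2.lf.E₀) (hB₀ : 0 ≤ θ.s2.lf.B₀)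
    (hsel : θ.ppSel = ppSelLiveOfRecord F N θ.ν θ.τ9 (EOfRecord₁₃ F N θ) (wOfRecord₉ F N θ.toStage9Params)) :
    ∀ k, k < p.K → TLaw₁₃ F N θ p k → SLaw₁₃ F N θ p (k + 1) :=
  (rOpLeaf_VOfRecord₁₃_iff F N θ p).mp (rOpLeaf_VOfRecord₁₃_of_liveSel_of_rstep F N θ p hrstep hθ hκ hE₀ hB₀ hsel)

/-- **The run's `rOperation` leaf reads TRUE at a world bound to the C-binding of record over the Stage-13 view, at the live selector, from row `rstep` alone.**
[cite: Balaban1988Convergent, p.244; Balaban1989LargeFieldII, Thm 1 p.355 (bookkeeping at the record)] -/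
theorem rOperation_leavesP_of_liveSel₁₃_of_rstep (w : WorldP) (hup : w.up p = upOfRecord₅C F N (θ.toStage5₁₃ F N) p)
    (hrstep : ∀ (p : B12.RunParams) (k : ℕ) [DecidableEq (PBond (F.P p.K) (k + 1))], k < p.K →
      (towerRepOfRecord F N θ.ν θ.τ9 (slotsTOfRecord F N θ.ν θ.τ9 (EOfRecord₁₃ F N θ) (wOfRecord₉ F N θ.toStage9Params) θ.ppSel)
        θ.ppSel p (gOfRecord₁₃ F N θ p) (k + 1)).toRepData.ProvisosInt)
    (hθ : θ.Admissible F N) (hκ : 0 ≤ θ.s2.lf.κ) (hE₀ : 0 ≤ θ.s2.lf.E₀) (hB₀ : 0 ≤ θ.s2.lf.B₀)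
    (hsel : θ.ppSel = ppSelLiveOfRecord F N θ.ν θ.τ9 (EOfRecord₁₃ F N θ) (wOfRecord₉ F N θ.toStage9Params)) :
    (leavesP w p).rOperation :=
  rOperation_leavesP_of_idem_of_dead₁₃_of_rstep F N θ p w hup hrstep hθ hκ hE₀ hB₀ (fun k _ => ppSel_succ_idem_of_liveSel F N θ hsel p k)
    (fun k _ a hne V => dead_of_ppSel_succ_ne_of_liveSel F N θ hsel p k a hne V)

/-- **★ AT THE LIVE SELECTOR, `ρ_{k+1} = 𝐓ρ_k` ALMOST EVERYWHERE FROM ROW `rstep` ALONE**, `k < K`.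
[cite: Balaban1989LargeFieldI, (0.2)–(0.4) p.176, p.177 (i)–(ii); Balaban1988Convergent, (2.18) p.257, (3.24)–(3.25) p.270; Balaban1989LargeFieldII, Thm 1 p.355 (not exercised)] -/
theorem densOfRecord₁₃_succ_ae_eq_tdens_of_liveSel_of_rstep
    (hrstep : ∀ (p : B12.RunParams) (k : ℕ) [DecidableEq (PBond (F.P p.K) (k + 1))], k < p.K →
      (towerRepOfRecord F N θ.ν θ.τ9 (slotsTOfRecord F N θ.ν θ.τ9 (EOfRecord₁₃ F N θ) (wOfRecord₉ F N θ.toStage9Params) θ.ppSel)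
        θ.ppSel p (gOfRecord₁₃ F N θ p) (k + 1)).toRepData.ProvisosInt)
    (hsel : θ.ppSel = ppSelLiveOfRecord F N θ.ν θ.τ9 (EOfRecord₁₃ F N θ) (wOfRecord₉ F N θ.toStage9Params)) (k : ℕ) (hk : k < p.K) :
    densOfRecord₁₃ F N θ p (k + 1) =ᵐ[fieldMeasure (F.P p.K) (k + 1) (SU N)] tdensOfRecord₁₃ F N θ p k :=
  densOfRecord₁₃_succ_ae_eq_tdens_of_idem_of_dead_of_rstep F N θ p hrstep k hk (ppSel_succ_idem_of_liveSel F N θ hsel p k)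
    (fun a hne V => dead_of_ppSel_succ_ne_of_liveSel F N θ hsel p k a hne V)

/-- **★ AT THE LIVE SELECTOR: `TLaw` AT THE `LiveSeq` SEQUENCES ONLY ⇒ `SLaw₁₃ (k+1)` FROM ROW `rstep` ALONE** (K0a's `LiveSeq` currency; N11's per-level share of
Theorem 1 on the witness line). [cite: Balaban1988Convergent, §2 p.262, Thm 2 p.263, (3.24)–(3.25) p.270; Balaban1989LargeFieldI, (0.3) p.176, p.177 (i)–(ii)] -/
theorem sLaw₁₃_succ_of_tLawLiveSeq_of_liveSel_of_rstep
    (hrstep : ∀ (p : B12.RunParams) (k : ℕ) [DecidableEq (PBond (F.P p.K) (k + 1))], k < p.K →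
      (towerRepOfRecord F N θ.ν θ.τ9 (slotsTOfRecord F N θ.ν θ.τ9 (EOfRecord₁₃ F N θ) (wOfRecord₉ F N θ.toStage9Params) θ.ppSel)
        θ.ppSel p (gOfRecord₁₃ F N θ p) (k + 1)).toRepData.ProvisosInt)
    (hθ : θ.Admissible F N) (hκ : 0 ≤ θ.s2.lf.κ) (hE₀ : 0 ≤ θ.s2.lf.E₀) (hB₀ : 0 ≤ θ.s2.lf.B₀)
    (hsel : θ.ppSel = ppSelLiveOfRecord F N θ.ν θ.τ9 (EOfRecord₁₃ F N θ) (wOfRecord₉ F N θ.toStage9Params)) (k : ℕ) (hk : k < p.K)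
    (hT : ∃ (t : SeqOfRecord F θ.ν θ.τ9.M (gOfRecord₁₃ F N θ p) p.K (k + 1) → Sect2.TermValues (F.P p.K) (MatA N) (FluctV N) θ.τ9.M)
      (Ek : SeqOfRecord F θ.ν θ.τ9.M (gOfRecord₁₃ F N θ p) p.K (k + 1) → ℝ), Sect2.UniversalE t ∧
      ∀ s, Sect2.LawsT (sect2TowerOfRecord F N (FluctV N) p.K (settingOfRecord₁₃ F N θ p) (θ.Rz p.K) s (t s)) (settingOfRecord₁₃ F N θ p).lf
          (settingOfRecord₁₃ F N θ p).βc k ∧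
        (LiveSeq F N θ.ν θ.τ9 p (gOfRecord₁₃ F N θ p) (k + 1)
            (slotsTOfRecord F N θ.ν θ.τ9 (EOfRecord₁₃ F N θ) (wOfRecord₉ F N θ.toStage9Params) θ.ppSel p (gOfRecord₁₃ F N θ p) (k + 1)) s →
          (slotsTOfRecord F N θ.ν θ.τ9 (EOfRecord₁₃ F N θ) (wOfRecord₉ F N θ.toStage9Params) θ.ppSel p (gOfRecord₁₃ F N θ p) (k + 1) s = 0 ∨
            ∀ᵐ V ∂(fieldMeasure (F.P p.K) (k + 1) (SU N)), chiSeqOfRecord F N θ.ν θ.τ9.M (gOfRecord₁₃ F N θ p) p.K (k + 1) s V ≠ 0 →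
              slotsTOfRecord F N θ.ν θ.τ9 (EOfRecord₁₃ F N θ) (wOfRecord₉ F N θ.toStage9Params) θ.ppSel p (gOfRecord₁₃ F N θ p) (k + 1) s V
                = sect2Slot F N (FluctV N) p.K (settingOfRecord₁₃ F N θ p) (θ.Rz p.K) (WtOfRecord₁₃ F N θ p) s (t s) (Ek s)
                    (UbgOfRecord₁₃ F N θ p (k + 1) s) V))) :
    SLaw₁₃ F N θ p (k + 1) := by
  obtain ⟨t, Ek, hu, hs⟩ := hT
  refine sLaw₁₃_succ_of_tLawLive_of_idem_of_dead_of_rstep F N θ p hrstep hθ hκ hE₀ hB₀ k hk (ppSel_succ_idem_of_liveSel F N θ hsel p k)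
    (fun a hne V => dead_of_ppSel_succ_ne_of_liveSel F N θ hsel p k a hne V)
    ⟨t, Ek, hu, fun s => ⟨(hs s).1, fun ⟨V, hV⟩ => (hs s).2 ?_⟩⟩
  obtain ⟨W, hf, hI⟩ := exists_live_of_fibreIntegral_rterm_ne_zero
    (sliceOfRecord F N θ.ν θ.τ9.M p (gOfRecord₁₃ F N θ p) (k + 1)
      (slotsTOfRecord F N θ.ν θ.τ9 (EOfRecord₁₃ F N θ) (wOfRecord₉ F N θ.toStage9Params) θ.ppSel p (gOfRecord₁₃ F N θ p) (k + 1)))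
    (fibOfSeq F θ.ν θ.τ9 p (gOfRecord₁₃ F N θ p) (k + 1)) s V hV
  exact liveSeq_of_ne_zero F N _ hf hI

/-- **★ THEOREM 1 [III] AT THE LIVE SELECTOR FROM (S1ᵀ) AT THE `LiveSeq` SEQUENCES ONLY, FROM ROW `rstep` ALONE** (induction from `sLaw₁₃_zero`).
[cite: Balaban1988Convergent, Thm 1 p.262; Theorem p.245; p.244; Balaban1989LargeFieldI, (0.3) p.176, p.177 (i)–(ii)] -/
theorem sLaw₁₃_all_of_thmP245LiveSeq_of_liveSel_of_rstep
    (hrstep : ∀ (p : B12.RunParams) (k : ℕ) [DecidableEq (PBond (F.P p.K) (k + 1))], k < p.K →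
      (towerRepOfRecord F N θ.ν θ.τ9 (slotsTOfRecord F N θ.ν θ.τ9 (EOfRecord₁₃ F N θ) (wOfRecord₉ F N θ.toStage9Params) θ.ppSel)
        θ.ppSel p (gOfRecord₁₃ F N θ p) (k + 1)).toRepData.ProvisosInt)
    (hθ : θ.Admissible F N) (hκ : 0 ≤ θ.s2.lf.κ) (hE₀ : 0 ≤ θ.s2.lf.E₀) (hB₀ : 0 ≤ θ.s2.lf.B₀)
    (hsel : θ.ppSel = ppSelLiveOfRecord F N θ.ν θ.τ9 (EOfRecord₁₃ F N θ) (wOfRecord₉ F N θ.toStage9Params))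
    (hT : ∀ k, k < p.K → SLaw₁₃ F N θ p k →
      ∃ (t : SeqOfRecord F θ.ν θ.τ9.M (gOfRecord₁₃ F N θ p) p.K (k + 1) → Sect2.TermValues (F.P p.K) (MatA N) (FluctV N) θ.τ9.M)
      (Ek : SeqOfRecord F θ.ν θ.τ9.M (gOfRecord₁₃ F N θ p) p.K (k + 1) → ℝ), Sect2.UniversalE t ∧
      ∀ s, Sect2.LawsT (sect2TowerOfRecord F N (FluctV N) p.K (settingOfRecord₁₃ F N θ p) (θ.Rz p.K) s (t s)) (settingOfRecord₁₃ F N θ p).lf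
          (settingOfRecord₁₃ F N θ p).βc k ∧
        (LiveSeq F N θ.ν θ.τ9 p (gOfRecord₁₃ F N θ p) (k + 1)
            (slotsTOfRecord F N θ.ν θ.τ9 (EOfRecord₁₃ F N θ) (wOfRecord₉ F N θ.toStage9Params) θ.ppSel p (gOfRecord₁₃ F N θ p) (k + 1)) s →
          (slotsTOfRecord F N θ.ν θ.τ9 (EOfRecord₁₃ F N θ) (wOfRecord₉ F N θ.toStage9Params) θ.ppSel p (gOfRecord₁₃ F N θ p) (k + 1) s = 0 ∨
            ∀ᵐ V ∂(fieldMeasure (F.P p.K) (k + 1) (SU N)), chiSeqOfRecord F N θ.ν θ.τ9.M (gOfRecord₁₃ F N θ p) p.K (k + 1) s V ≠ 0 →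
              slotsTOfRecord F N θ.ν θ.τ9 (EOfRecord₁₃ F N θ) (wOfRecord₉ F N θ.toStage9Params) θ.ppSel p (gOfRecord₁₃ F N θ p) (k + 1) s V
                = sect2Slot F N (FluctV N) p.K (settingOfRecord₁₃ F N θ p) (θ.Rz p.K) (WtOfRecord₁₃ F N θ p) s (t s) (Ek s)
                    (UbgOfRecord₁₃ F N θ p (k + 1) s) V))) :
    ∀ k, k ≤ p.K → SLaw₁₃ F N θ p k := by
  intro k
  induction k with
  | zero => exact fun _ => sLaw₁₃_zero F N θ p
  | succ n ih =>
    intro hk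
    exact sLaw₁₃_succ_of_tLawLiveSeq_of_liveSel_of_rstep F N θ p hrstep hθ hκ hE₀ hB₀ hsel n (Nat.lt_of_succ_le hk)
      (hT n (Nat.lt_of_succ_le hk) (ih (Nat.le_of_succ_le hk)))

/-- **THEOREM 1 [III] AT THE LIVE SELECTOR FROM THE FULL (S1ᵀ), from row `rstep` alone** (law reading `SLaw₁₃ k → TLaw₁₃ k`).
[cite: Balaban1988Convergent, Thm 1 p.262; Theorem p.245; p.244] -/
theorem sLaw₁₃_all_of_thmP245_of_liveSel_of_rstep
    (hrstep : ∀ (p : B12.RunParams) (k : ℕ) [DecidableEq (PBond (F.P p.K) (k + 1))], k < p.K →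
      (towerRepOfRecord F N θ.ν θ.τ9 (slotsTOfRecord F N θ.ν θ.τ9 (EOfRecord₁₃ F N θ) (wOfRecord₉ F N θ.toStage9Params) θ.ppSel)
        θ.ppSel p (gOfRecord₁₃ F N θ p) (k + 1)).toRepData.ProvisosInt)
    (hθ : θ.Admissible F N) (hκ : 0 ≤ θ.s2.lf.κ) (hE₀ : 0 ≤ θ.s2.lf.E₀) (hB₀ : 0 ≤ θ.s2.lf.B₀)
    (hsel : θ.ppSel = ppSelLiveOfRecord F N θ.ν θ.τ9 (EOfRecord₁₃ F N θ) (wOfRecord₉ F N θ.toStage9Params))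
    (hT : ∀ k, k < p.K → SLaw₁₃ F N θ p k → TLaw₁₃ F N θ p k) :
    ∀ k, k ≤ p.K → SLaw₁₃ F N θ p k :=
  sLaw₁₃_all_of_laws F N θ p (laws₁₃_of_liveSel_of_rstep F N θ p hrstep hθ hκ hE₀ hB₀ hsel) hT

variable {F N θ} in
/-- **★ AT THE LIVE SELECTOR THE ROW `rstep` IS A THEOREM OF K0b's `HasResidualsOfRecord` ALONE**: node00-def-T's §4c `rstep₁₃_of_localBg_liveSel` (def-R's
`provisosInt_towerRepOfRecord_of_sel_fixed_or_null` over the dichotomy `ppSelLiveOfRecord_fixed_or_dead`) with (H-U) DISCHARGED by seat K0c's absolute theorem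
`localBgMeasurable` and the ζ-inputs read off the (3.16) factor of record (`zetaMeasurable_zeta316OfRecord_of_localBg`, `HasResidualsOfRecord.zetaAbs`,
`zeta316OfRecord_nonneg`) — exactly the `rstep` line of K0a's `provisos₁₃_liveRepin₁₃_of_localBg`, stated as its own theorem at the selector clause.
[cite: Balaban1989LargeFieldI, (0.3)–(0.4) p.176 and p.177; Balaban1988Convergent, (2.12) p.256, (3.16) p.268, (3.22) p.269, (3.24)–(3.25) p.270 (bookkeeping)] -/
theorem rstep₁₃_of_liveSel_of_hasResiduals
    (hsel : θ.ppSel = ppSelLiveOfRecord F N θ.ν θ.τ9 (EOfRecord₁₃ F N θ) (wOfRecord₉ F N θ.toStage9Params)) (hres : θ.HasResidualsOfRecord F N) :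
    ∀ (p : B12.RunParams) (k : ℕ) [DecidableEq (PBond (F.P p.K) (k + 1))], k < p.K →
      (towerRepOfRecord F N θ.ν θ.τ9 (slotsTOfRecord F N θ.ν θ.τ9 (EOfRecord₁₃ F N θ) (wOfRecord₉ F N θ.toStage9Params) θ.ppSel)
        θ.ppSel p (gOfRecord₁₃ F N θ p) (k + 1)).toRepData.ProvisosInt :=
  have hζ : ZetaMeasurable F N θ.ζ := by
    rw [hres.zeta_eq]; exact zetaMeasurable_zeta316OfRecord_of_localBg (localBgMeasurable F N θ.ν) θ.τ9.M θ.A₁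
  have hζ0 : ∀ p g k s Pl Ql RS U V', 0 ≤ θ.ζ p g k s Pl Ql RS U V' := by
    rw [hres.zeta_eq]; exact fun p g k s Pl Ql RS U V' => zeta316OfRecord_nonneg θ.A₁ p g k s Pl Ql RS U V'
  θ.rstep₁₃_of_localBg_liveSel hsel (localBgMeasurable F N θ.ν) hζ hres.zetaAbs hζ0

/-- **★★ THE 𝐑-LEAF OF RECORD AT THE LIVE SELECTOR FROM K0b's `HasResidualsOfRecord`, ADMISSIBILITY AND THE TERM-CONSTANT SIGNS — NO PROVISO FIELD AT ALL**
(in particular NO row P11 `bg`): N13's conjunct `ROpLeaf (VOfRecord₁₃ θ p)` on the live line.  HONEST SCOPE: 𝐑 integrates out only terms of zero fibre mass here;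
[B16] Theorem 1's 𝐑-construction is not exercised. [cite: Balaban1988Convergent, p.244, Thm 2 p.263, (3.16) p.268; Balaban1989LargeFieldI, (0.3)–(0.4) p.176, p.177 (i)–(ii); Balaban1989LargeFieldII, Thm 1 p.355 (not exercised)] -/
theorem rOpLeaf_VOfRecord₁₃_of_liveSel_of_hasResiduals (hres : θ.HasResidualsOfRecord F N) (hθ : θ.Admissible F N) (hκ : 0 ≤ θ.s2.lf.κ)
    (hE₀ : 0 ≤ θ.s2.lf.E₀) (hB₀ : 0 ≤ θ.s2.lf.B₀)
    (hsel : θ.ppSel = ppSelLiveOfRecord F N θ.ν θ.τ9 (EOfRecord₁₃ F N θ) (wOfRecord₉ F N θ.toStage9Params)) :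
    ROpLeaf (VOfRecord₁₃ F N θ p) :=
  rOpLeaf_VOfRecord₁₃_of_liveSel_of_rstep F N θ p (rstep₁₃_of_liveSel_of_hasResiduals hsel hres) hθ hκ hE₀ hB₀ hsel

/-- **The (R₁₃) slot in law form at the live selector from `HasResidualsOfRecord` alone** (+ admissibility, signs) — `hR13` ∕ `rRow` of the Stage-13 knits SUPPLIED
with no proviso. [cite: Balaban1988Convergent, p.244 (bookkeeping); Balaban1989LargeFieldII, Thm 1 p.355 (not exercised)] -/
theorem laws₁₃_of_liveSel_of_hasResiduals (hres : θ.HasResidualsOfRecord F N) (hθ : θ.Admissible F N) (hκ : 0 ≤ θ.s2.lf.κ) (hE₀ : 0 ≤ θ.s2.lf.E₀)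
    (hB₀ : 0 ≤ θ.s2.lf.B₀) (hsel : θ.ppSel = ppSelLiveOfRecord F N θ.ν θ.τ9 (EOfRecord₁₃ F N θ) (wOfRecord₉ F N θ.toStage9Params)) :
    ∀ k, k < p.K → TLaw₁₃ F N θ p k → SLaw₁₃ F N θ p (k + 1) :=
  laws₁₃_of_liveSel_of_rstep F N θ p (rstep₁₃_of_liveSel_of_hasResiduals hsel hres) hθ hκ hE₀ hB₀ hsel

/-- **The run's `rOperation` leaf reads TRUE at a world bound to the C-binding of record over the Stage-13 view, at the live selector, from `HasResidualsOfRecord`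
alone** (+ admissibility, signs). [cite: Balaban1988Convergent, p.244; Balaban1989LargeFieldII, Thm 1 p.355 (bookkeeping at the record)] -/
theorem rOperation_leavesP_of_liveSel₁₃_of_hasResiduals (w : WorldP) (hup : w.up p = upOfRecord₅C F N (θ.toStage5₁₃ F N) p)
    (hres : θ.HasResidualsOfRecord F N) (hθ : θ.Admissible F N) (hκ : 0 ≤ θ.s2.lf.κ) (hE₀ : 0 ≤ θ.s2.lf.E₀) (hB₀ : 0 ≤ θ.s2.lf.B₀)
    (hsel : θ.ppSel = ppSelLiveOfRecord F N θ.ν θ.τ9 (EOfRecord₁₃ F N θ) (wOfRecord₉ F N θ.toStage9Params)) :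
    (leavesP w p).rOperation :=
  rOperation_leavesP_of_liveSel₁₃_of_rstep F N θ p w hup (rstep₁₃_of_liveSel_of_hasResiduals hsel hres) hθ hκ hE₀ hB₀ hsel

/-- **★ AT THE LIVE SELECTOR, `ρ_{k+1} = 𝐓ρ_k` ALMOST EVERYWHERE FROM `HasResidualsOfRecord` ALONE**, `k < K` — 𝐑 of record is the identity up to null sets on the
live line, with NO proviso field read. [cite: Balaban1989LargeFieldI, (0.2)–(0.4) p.176, p.177 (i)–(ii); Balaban1988Convergent, (2.18) p.257, (3.16) p.268, (3.24)–(3.25) p.270] -/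
theorem densOfRecord₁₃_succ_ae_eq_tdens_of_liveSel_of_hasResiduals (hres : θ.HasResidualsOfRecord F N)
    (hsel : θ.ppSel = ppSelLiveOfRecord F N θ.ν θ.τ9 (EOfRecord₁₃ F N θ) (wOfRecord₉ F N θ.toStage9Params)) (k : ℕ) (hk : k < p.K) :
    densOfRecord₁₃ F N θ p (k + 1) =ᵐ[fieldMeasure (F.P p.K) (k + 1) (SU N)] tdensOfRecord₁₃ F N θ p k :=
  densOfRecord₁₃_succ_ae_eq_tdens_of_liveSel_of_rstep F N θ p (rstep₁₃_of_liveSel_of_hasResiduals hsel hres) hsel k hk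

/-- **★ THEOREM 1 [III] AT THE LIVE SELECTOR FROM (S1ᵀ) AT THE `LiveSeq` SEQUENCES ONLY, FROM `HasResidualsOfRecord` ALONE** (+ admissibility, signs): every
`ρ_k` of record, `k ≤ K`, has the repaired §2 form — N11's share is the only displayed analysis. [cite: Balaban1988Convergent, Thm 1 p.262; Theorem p.245; p.244; Balaban1989LargeFieldI, (0.3) p.176, p.177 (i)–(ii)] -/
theorem sLaw₁₃_all_of_thmP245LiveSeq_of_liveSel_of_hasResiduals (hres : θ.HasResidualsOfRecord F N) (hθ : θ.Admissible F N)
    (hκ : 0 ≤ θ.s2.lf.κ) (hE₀ : 0 ≤ θ.s2.lf.E₀) (hB₀ : 0 ≤ θ.s2.lf.B₀)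
    (hsel : θ.ppSel = ppSelLiveOfRecord F N θ.ν θ.τ9 (EOfRecord₁₃ F N θ) (wOfRecord₉ F N θ.toStage9Params))
    (hT : ∀ k, k < p.K → SLaw₁₃ F N θ p k →
      ∃ (t : SeqOfRecord F θ.ν θ.τ9.M (gOfRecord₁₃ F N θ p) p.K (k + 1) → Sect2.TermValues (F.P p.K) (MatA N) (FluctV N) θ.τ9.M)
      (Ek : SeqOfRecord F θ.ν θ.τ9.M (gOfRecord₁₃ F N θ p) p.K (k + 1) → ℝ), Sect2.UniversalE t ∧
      ∀ s, Sect2.LawsT (sect2TowerOfRecord F N (FluctV N) p.K (settingOfRecord₁₃ F N θ p) (θ.Rz p.K) s (t s)) (settingOfRecord₁₃ F N θ p).lf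
          (settingOfRecord₁₃ F N θ p).βc k ∧
        (LiveSeq F N θ.ν θ.τ9 p (gOfRecord₁₃ F N θ p) (k + 1)
            (slotsTOfRecord F N θ.ν θ.τ9 (EOfRecord₁₃ F N θ) (wOfRecord₉ F N θ.toStage9Params) θ.ppSel p (gOfRecord₁₃ F N θ p) (k + 1)) s →
          (slotsTOfRecord F N θ.ν θ.τ9 (EOfRecord₁₃ F N θ) (wOfRecord₉ F N θ.toStage9Params) θ.ppSel p (gOfRecord₁₃ F N θ p) (k + 1) s = 0 ∨
            ∀ᵐ V ∂(fieldMeasure (F.P p.K) (k + 1) (SU N)), chiSeqOfRecord F N θ.ν θ.τ9.M (gOfRecord₁₃ F N θ p) p.K (k + 1) s V ≠ 0 →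
              slotsTOfRecord F N θ.ν θ.τ9 (EOfRecord₁₃ F N θ) (wOfRecord₉ F N θ.toStage9Params) θ.ppSel p (gOfRecord₁₃ F N θ p) (k + 1) s V
                = sect2Slot F N (FluctV N) p.K (settingOfRecord₁₃ F N θ p) (θ.Rz p.K) (WtOfRecord₁₃ F N θ p) s (t s) (Ek s)
                    (UbgOfRecord₁₃ F N θ p (k + 1) s) V))) :
    ∀ k, k ≤ p.K → SLaw₁₃ F N θ p k :=
  sLaw₁₃_all_of_thmP245LiveSeq_of_liveSel_of_rstep F N θ p (rstep₁₃_of_liveSel_of_hasResiduals hsel hres) hθ hκ hE₀ hB₀ hsel hT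

/-- **THEOREM 1 [III] AT THE LIVE SELECTOR FROM THE FULL (S1ᵀ), FROM `HasResidualsOfRecord` ALONE** (+ admissibility, signs).
[cite: Balaban1988Convergent, Thm 1 p.262; Theorem p.245; p.244] -/
theorem sLaw₁₃_all_of_thmP245_of_liveSel_of_hasResiduals (hres : θ.HasResidualsOfRecord F N) (hθ : θ.Admissible F N) (hκ : 0 ≤ θ.s2.lf.κ)
    (hE₀ : 0 ≤ θ.s2.lf.E₀) (hB₀ : 0 ≤ θ.s2.lf.B₀)
    (hsel : θ.ppSel = ppSelLiveOfRecord F N θ.ν θ.τ9 (EOfRecord₁₃ F N θ) (wOfRecord₉ F N θ.toStage9Params))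
    (hT : ∀ k, k < p.K → SLaw₁₃ F N θ p k → TLaw₁₃ F N θ p k) :
    ∀ k, k ≤ p.K → SLaw₁₃ F N θ p k :=
  sLaw₁₃_all_of_laws F N θ p (laws₁₃_of_liveSel_of_hasResiduals F N θ p hres hθ hκ hE₀ hB₀ hsel) hT

end LiveSel

/-! ## §3  AT K0a's STAGE-13 LIVE RE-PIN `θ.liveRepin₁₃` (the selector clause is `rfl`): everything from `HasResidualsOfRecord` alone -/

section Repin

variable (θ : Stage13Params F N) (p : B12.RunParams)

/-- **★★ THE 𝐑-LEAF OF RECORD AT THE LIVE RE-PIN OF ANY PARAMETER CARRYING K0b's RESIDUALS — from admissibility and the three term-constant signs of `θ` alone**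
(no `Provisos₁₃`, no `bg`). [cite: Balaban1988Convergent, p.244, Thm 2 p.263, (3.16) p.268; Balaban1989LargeFieldI, (0.3)–(0.4) p.176, p.177 (i)–(ii); Balaban1989LargeFieldII, Thm 1 p.355 (not exercised)] -/
theorem rOpLeaf_VOfRecord₁₃_liveRepin₁₃_of_hasResiduals (hres : θ.HasResidualsOfRecord F N) (hθ : θ.Admissible F N) (hκ : 0 ≤ θ.s2.lf.κ)
    (hE₀ : 0 ≤ θ.s2.lf.E₀) (hB₀ : 0 ≤ θ.s2.lf.B₀) : ROpLeaf (VOfRecord₁₃ F N (θ.liveRepin₁₃ F N) p) :=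
  rOpLeaf_VOfRecord₁₃_of_liveSel_of_hasResiduals F N (θ.liveRepin₁₃ F N) p (Stage13Params.HasResidualsOfRecord.liveRepin₁₃ hres) hθ.liveRepin₁₃ hκ hE₀ hB₀ (liveRepin₁₃_liveSel F N θ)

/-- **The (R₁₃) slot in law form at the re-pin, from `HasResidualsOfRecord` alone** (+ admissibility, signs).
[cite: Balaban1988Convergent, p.244 (bookkeeping); Balaban1989LargeFieldII, Thm 1 p.355 (not exercised)] -/
theorem laws₁₃_liveRepin₁₃_of_hasResiduals (hres : θ.HasResidualsOfRecord F N) (hθ : θ.Admissible F N) (hκ : 0 ≤ θ.s2.lf.κ) (hE₀ : 0 ≤ θ.s2.lf.E₀)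
    (hB₀ : 0 ≤ θ.s2.lf.B₀) :
    ∀ k, k < p.K → TLaw₁₃ F N (θ.liveRepin₁₃ F N) p k → SLaw₁₃ F N (θ.liveRepin₁₃ F N) p (k + 1) :=
  laws₁₃_of_liveSel_of_hasResiduals F N (θ.liveRepin₁₃ F N) p (Stage13Params.HasResidualsOfRecord.liveRepin₁₃ hres) hθ.liveRepin₁₃ hκ hE₀ hB₀ (liveRepin₁₃_liveSel F N θ)

/-- **The run's `rOperation` leaf reads TRUE at a world bound to the C-binding of record over the re-pinned Stage-13 view, from `HasResidualsOfRecord` alone.**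
[cite: Balaban1988Convergent, p.244; Balaban1989LargeFieldII, Thm 1 p.355 (bookkeeping at the record)] -/
theorem rOperation_leavesP_liveRepin₁₃_of_hasResiduals (w : WorldP) (hup : w.up p = upOfRecord₅C F N ((θ.liveRepin₁₃ F N).toStage5₁₃ F N) p)
    (hres : θ.HasResidualsOfRecord F N) (hθ : θ.Admissible F N) (hκ : 0 ≤ θ.s2.lf.κ) (hE₀ : 0 ≤ θ.s2.lf.E₀) (hB₀ : 0 ≤ θ.s2.lf.B₀) :
    (leavesP w p).rOperation :=
  rOperation_leavesP_of_liveSel₁₃_of_hasResiduals F N (θ.liveRepin₁₃ F N) p w hup (Stage13Params.HasResidualsOfRecord.liveRepin₁₃ hres) hθ.liveRepin₁₃ hκ hE₀ hB₀ (liveRepin₁₃_liveSel F N θ)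

/-- **★ `ρ_{k+1} = 𝐓ρ_k` ALMOST EVERYWHERE AT THE RE-PIN, from `HasResidualsOfRecord` alone**, `k < K`.
[cite: Balaban1989LargeFieldI, (0.2)–(0.4) p.176, p.177 (i)–(ii); Balaban1988Convergent, (2.18) p.257, (3.16) p.268, (3.24)–(3.25) p.270] -/
theorem densOfRecord₁₃_succ_ae_eq_tdens_liveRepin₁₃_of_hasResiduals (hres : θ.HasResidualsOfRecord F N) (k : ℕ) (hk : k < p.K) :
    densOfRecord₁₃ F N (θ.liveRepin₁₃ F N) p (k + 1) =ᵐ[fieldMeasure (F.P p.K) (k + 1) (SU N)] tdensOfRecord₁₃ F N (θ.liveRepin₁₃ F N) p k :=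
  densOfRecord₁₃_succ_ae_eq_tdens_of_liveSel_of_hasResiduals F N (θ.liveRepin₁₃ F N) p (Stage13Params.HasResidualsOfRecord.liveRepin₁₃ hres) (liveRepin₁₃_liveSel F N θ) k hk

/-- **THEOREM 1 [III] AT THE RE-PINNED OBJECTS OF RECORD FROM THE FULL (S1ᵀ), from `HasResidualsOfRecord` alone** (+ admissibility, signs).
[cite: Balaban1988Convergent, Thm 1 p.262; Theorem p.245; p.244] -/
theorem sLaw₁₃_all_liveRepin₁₃_of_thmP245_of_hasResiduals (hres : θ.HasResidualsOfRecord F N) (hθ : θ.Admissible F N) (hκ : 0 ≤ θ.s2.lf.κ)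
    (hE₀ : 0 ≤ θ.s2.lf.E₀) (hB₀ : 0 ≤ θ.s2.lf.B₀)
    (hT : ∀ k, k < p.K → SLaw₁₃ F N (θ.liveRepin₁₃ F N) p k → TLaw₁₃ F N (θ.liveRepin₁₃ F N) p k) :
    ∀ k, k ≤ p.K → SLaw₁₃ F N (θ.liveRepin₁₃ F N) p k :=
  sLaw₁₃_all_of_thmP245_of_liveSel_of_hasResiduals F N (θ.liveRepin₁₃ F N) p (Stage13Params.HasResidualsOfRecord.liveRepin₁₃ hres) hθ.liveRepin₁₃ hκ hE₀ hB₀ (liveRepin₁₃_liveSel F N θ) hT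

end Repin

/-! ## §4  AT THE WITNESSES CARRYING K0b's RESIDUALS: the (R₁₃) slot CLOSED -/

section Family

variable {ε₀ : ℝ} (p : B12.RunParams)

/-- **★★ THE 𝐑-LEAF OF RECORD AT K0a's FAMILY WITNESS `θ₁₃(ε₀)` (K0b's residuals), from `0 < ε₀` ALONE.**
[cite: Balaban1988Convergent, p.244, Thm 2 p.263, (3.16) p.268; Balaban1989LargeFieldI, (0.3)–(0.4) p.176, p.177 (i)–(ii); Balaban1989LargeFieldII, Thm 1 p.355 (not exercised)] -/
theorem rOpLeaf_VOfRecord₁₃_theta13LiveOfFamily (hε : 0 < ε₀) :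
    ROpLeaf (VOfRecord₁₃ F N
      (theta13LiveOfFamily F N ε₀ (zeta316OfRecord F N (numerics7OfFamily ε₀) 1 1) (RzOfRecord F N) (ZtOfRecord F N)) p) :=
  rOpLeaf_VOfRecord₁₃_liveRepin₁₃_of_hasResiduals F N (theta13OfFamily F N ε₀ _ _ _) p (hasResidualsOfRecord_theta13OfFamily F N ε₀)
    (admissible_theta13OfFamily F N _ _ _ hε) (kappa_nonneg_theta13LiveOfFamily F N ε₀ (zeta316OfRecord F N (numerics7OfFamily ε₀) 1 1) (RzOfRecord F N) (ZtOfRecord F N)) (E0_nonneg_theta13LiveOfFamily F N ε₀ (zeta316OfRecord F N (numerics7OfFamily ε₀) 1 1) (RzOfRecord F N) (ZtOfRecord F N))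
    (B0_nonneg_theta13LiveOfFamily F N ε₀ (zeta316OfRecord F N (numerics7OfFamily ε₀) 1 1) (RzOfRecord F N) (ZtOfRecord F N))

/-- **The (R₁₃) slot in law form at `θ₁₃(ε₀)`, from `0 < ε₀` alone.** [cite: Balaban1988Convergent, p.244 (bookkeeping); Balaban1989LargeFieldII, Thm 1 p.355 (not exercised)] -/
theorem laws₁₃_theta13LiveOfFamily (hε : 0 < ε₀) :
    ∀ k, k < p.K →
      TLaw₁₃ F N (theta13LiveOfFamily F N ε₀ (zeta316OfRecord F N (numerics7OfFamily ε₀) 1 1) (RzOfRecord F N) (ZtOfRecord F N)) p k →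
        SLaw₁₃ F N (theta13LiveOfFamily F N ε₀ (zeta316OfRecord F N (numerics7OfFamily ε₀) 1 1) (RzOfRecord F N) (ZtOfRecord F N)) p (k + 1) :=
  (rOpLeaf_VOfRecord₁₃_iff F N _ p).mp (rOpLeaf_VOfRecord₁₃_theta13LiveOfFamily F N p hε)

/-- **`ρ_{k+1} = 𝐓ρ_k` a.e. at `θ₁₃(ε₀)` (K0b's residuals), `k < K`, NO hypothesis on `ε₀`.**
[cite: Balaban1989LargeFieldI, (0.2)–(0.4) p.176, p.177 (i)–(ii); Balaban1988Convergent, (3.16) p.268, (3.24)–(3.25) p.270] -/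
theorem densOfRecord₁₃_succ_ae_eq_tdens_theta13LiveOfFamily (ε₀ : ℝ) (k : ℕ) (hk : k < p.K) :
    densOfRecord₁₃ F N (theta13LiveOfFamily F N ε₀ (zeta316OfRecord F N (numerics7OfFamily ε₀) 1 1) (RzOfRecord F N) (ZtOfRecord F N)) p (k + 1)
      =ᵐ[fieldMeasure (F.P p.K) (k + 1) (SU N)]
      tdensOfRecord₁₃ F N (theta13LiveOfFamily F N ε₀ (zeta316OfRecord F N (numerics7OfFamily ε₀) 1 1) (RzOfRecord F N) (ZtOfRecord F N)) p k :=
  densOfRecord₁₃_succ_ae_eq_tdens_liveRepin₁₃_of_hasResiduals F N (theta13OfFamily F N ε₀ _ _ _) p (hasResidualsOfRecord_theta13OfFamily F N ε₀) k hk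

end Family

section OfRecord

variable (p : B12.RunParams)

/-- **★★★ THE 𝐑-LEAF OF RECORD AT THE STAGE-13 WITNESS OF RECORD — A CLOSED THEOREM, ZERO HYPOTHESES**: `ROpLeaf (VOfRecord₁₃ F N θ₁₃ p)` at
`θ₁₃ = theta13LiveOfRecord F N` for every run `p`.  N13's conjunct on the K0‴ witness line of record costs NOTHING: on the live line 𝐑 of record integrates out only
terms of zero fibre mass ([I] p. 177 (i)–(ii) bookkeeping), def-R's (0.3) provisos there are theorems of (H-U) (absolute, seat K0c) and the ζ-laws of the (3.16) factor
of record, admissibility and the signs are the family's numerals.  NOT row P11, NOT [15], NOT `Provisos₁₃`.  HONEST SCOPE: [B16] Theorem 1's 𝐑-construction is not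
exercised at this witness. [cite: Balaban1988Convergent, p.244, Thm 2 p.263, (3.16) p.268, (3.22) p.269; Balaban1989LargeFieldI, (0.3)–(0.4) p.176, p.177 (i)–(ii); Balaban1989LargeFieldII, Thm 1 p.355 (not exercised)] -/
theorem rOpLeaf_VOfRecord₁₃_theta13LiveOfRecord : ROpLeaf (VOfRecord₁₃ F N (theta13LiveOfRecord F N) p) :=
  rOpLeaf_VOfRecord₁₃_theta13LiveOfFamily F N p eps0OfRecord₁₃_pos

/-- **★★★ THE (R₁₃) SLOT IN LAW FORM AT THE WITNESS OF RECORD — CLOSED**: `∀ k < K, TLaw₁₃ θ₁₃ p k → SLaw₁₃ θ₁₃ p (k+1)` (the `hR13` slot of dag-n24-c's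
Stage-13 knit ∕ n12's `rRow` ∕ dag-n11-d's `sLaw₁₃_all_of_tLaw` at the witness, DISCHARGED outright). [cite: Balaban1988Convergent, p.244 (bookkeeping); Balaban1989LargeFieldII, Thm 1 p.355 (not exercised)] -/
theorem laws₁₃_theta13LiveOfRecord :
    ∀ k, k < p.K → TLaw₁₃ F N (theta13LiveOfRecord F N) p k → SLaw₁₃ F N (theta13LiveOfRecord F N) p (k + 1) :=
  (rOpLeaf_VOfRecord₁₃_iff F N _ p).mp (rOpLeaf_VOfRecord₁₃_theta13LiveOfRecord F N p)

/-- **The run's `rOperation` leaf reads TRUE at every world bound to the C-binding of record over the witness's Stage-13 view — no further hypothesis.**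
[cite: Balaban1988Convergent, p.244; Balaban1989LargeFieldII, Thm 1 p.355 (bookkeeping at the record)] -/
theorem rOperation_leavesP_theta13LiveOfRecord (w : WorldP)
    (hup : w.up p = upOfRecord₅C F N ((theta13LiveOfRecord F N).toStage5₁₃ F N) p) : (leavesP w p).rOperation := by
  show (w.up p).rOperation
  rw [hup, rOperation_upOfRecord₅C_stage13_iff]
  exact laws₁₃_theta13LiveOfRecord F N p

/-- **★★ `ρ_{k+1} = 𝐓ρ_k` ALMOST EVERYWHERE AT THE WITNESS OF RECORD — CLOSED**, `k < K`: 𝐑 of record changes no density of any run beyond a null set.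
[cite: Balaban1989LargeFieldI, (0.2)–(0.4) p.176, p.177 (i)–(ii); Balaban1988Convergent, (2.18) p.257, (3.16) p.268, (3.24)–(3.25) p.270] -/
theorem densOfRecord₁₃_succ_ae_eq_tdens_theta13LiveOfRecord_closed (k : ℕ) (hk : k < p.K) :
    densOfRecord₁₃ F N (theta13LiveOfRecord F N) p (k + 1) =ᵐ[fieldMeasure (F.P p.K) (k + 1) (SU N)]
      tdensOfRecord₁₃ F N (theta13LiveOfRecord F N) p k :=
  densOfRecord₁₃_succ_ae_eq_tdens_theta13LiveOfFamily F N p eps0OfRecord₁₃ k hk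

/-- **THEOREM 1 [III] AT THE WITNESS OF RECORD FROM THE FULL (S1ᵀ) ALONE** (law reading; the 𝐑-slot, admissibility, signs and every proviso the chain reads are
theorems here): `∀ k ≤ K, SLaw₁₃ θ₁₃ p k`. [cite: Balaban1988Convergent, Thm 1 p.262; Theorem p.245; p.244] -/
theorem sLaw₁₃_all_theta13LiveOfRecord_of_thmP245
    (hT : ∀ k, k < p.K → SLaw₁₃ F N (theta13LiveOfRecord F N) p k → TLaw₁₃ F N (theta13LiveOfRecord F N) p k) :
    ∀ k, k ≤ p.K → SLaw₁₃ F N (theta13LiveOfRecord F N) p k :=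
  sLaw₁₃_all_of_laws F N _ p (laws₁₃_theta13LiveOfRecord F N p) hT

end OfRecord

section Family₂

variable {ε₀ ε₂₉ : ℝ} (p : B12.RunParams)

/-- **★★ THE 𝐑-LEAF OF RECORD AT K0a's OPEN-LETTER FAMILY `θ₁₃(ε₀, ε₂₉)` (K0b's residuals), from `0 < ε₀`, `0 < ε₂₉` ALONE.**
[cite: Balaban1988Convergent, p.244, Thm 2 p.263, (3.16) p.268; Balaban1989LargeFieldI, (0.3)–(0.4) p.176, p.177 (i)–(ii); Balaban1989LargeFieldII, Thm 1 p.355 (not exercised)] -/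
theorem rOpLeaf_VOfRecord₁₃_theta13LiveOfFamily₂ (hε : 0 < ε₀) (hε' : 0 < ε₂₉) :
    ROpLeaf (VOfRecord₁₃ F N
      (theta13LiveOfFamily₂ F N ε₀ ε₂₉ (zeta316OfRecord F N (numerics7OfFamily ε₀) 1 1) (RzOfRecord F N) (ZtOfRecord F N)) p) :=
  rOpLeaf_VOfRecord₁₃_liveRepin₁₃_of_hasResiduals F N (theta13OfFamily₂ F N ε₀ ε₂₉ _ _ _) p (hasResidualsOfRecord_theta13OfFamily₂ F N ε₀ ε₂₉)
    (admissible_theta13OfFamily₂ F N _ _ _ hε hε') (kappa_nonneg_theta13LiveOfFamily₂ F N ε₀ ε₂₉ (zeta316OfRecord F N (numerics7OfFamily ε₀) 1 1) (RzOfRecord F N) (ZtOfRecord F N))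
    (E0_nonneg_theta13LiveOfFamily₂ F N ε₀ ε₂₉ (zeta316OfRecord F N (numerics7OfFamily ε₀) 1 1) (RzOfRecord F N) (ZtOfRecord F N)) (B0_nonneg_theta13LiveOfFamily₂ F N ε₀ ε₂₉ (zeta316OfRecord F N (numerics7OfFamily ε₀) 1 1) (RzOfRecord F N) (ZtOfRecord F N))

/-- **The (R₁₃) slot in law form at `θ₁₃(ε₀, ε₂₉)`, from `0 < ε₀`, `0 < ε₂₉` alone.** [cite: Balaban1988Convergent, p.244 (bookkeeping); Balaban1989LargeFieldII, Thm 1 p.355 (not exercised)] -/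
theorem laws₁₃_theta13LiveOfFamily₂ (hε : 0 < ε₀) (hε' : 0 < ε₂₉) :
    ∀ k, k < p.K →
      TLaw₁₃ F N (theta13LiveOfFamily₂ F N ε₀ ε₂₉ (zeta316OfRecord F N (numerics7OfFamily ε₀) 1 1) (RzOfRecord F N) (ZtOfRecord F N)) p k →
        SLaw₁₃ F N (theta13LiveOfFamily₂ F N ε₀ ε₂₉ (zeta316OfRecord F N (numerics7OfFamily ε₀) 1 1) (RzOfRecord F N) (ZtOfRecord F N)) p (k + 1) :=
  (rOpLeaf_VOfRecord₁₃_iff F N _ p).mp (rOpLeaf_VOfRecord₁₃_theta13LiveOfFamily₂ F N p hε hε')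

/-- **`ρ_{k+1} = 𝐓ρ_k` a.e. at `θ₁₃(ε₀, ε₂₉)` (K0b's residuals), `k < K`, no letter hypothesis.**
[cite: Balaban1989LargeFieldI, (0.2)–(0.4) p.176, p.177 (i)–(ii); Balaban1988Convergent, (3.16) p.268, (3.24)–(3.25) p.270] -/
theorem densOfRecord₁₃_succ_ae_eq_tdens_theta13LiveOfFamily₂ (ε₀ ε₂₉ : ℝ) (k : ℕ) (hk : k < p.K) :
    densOfRecord₁₃ F N (theta13LiveOfFamily₂ F N ε₀ ε₂₉ (zeta316OfRecord F N (numerics7OfFamily ε₀) 1 1) (RzOfRecord F N) (ZtOfRecord F N)) p (k + 1)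
      =ᵐ[fieldMeasure (F.P p.K) (k + 1) (SU N)]
      tdensOfRecord₁₃ F N (theta13LiveOfFamily₂ F N ε₀ ε₂₉ (zeta316OfRecord F N (numerics7OfFamily ε₀) 1 1) (RzOfRecord F N) (ZtOfRecord F N)) p k :=
  densOfRecord₁₃_succ_ae_eq_tdens_liveRepin₁₃_of_hasResiduals F N (theta13OfFamily₂ F N ε₀ ε₂₉ _ _ _) p
    (hasResidualsOfRecord_theta13OfFamily₂ F N ε₀ ε₂₉) k hk

end Family₂

section Numerics

variable {n : Stage12Numerics} {ε₂₉ : ℝ} (p : B12.RunParams)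

/-- **★★ THE 𝐑-LEAF OF RECORD AT K0a's ALL-NUMERICS WITNESS `θ₁₃(n, ε₂₉)` (K0b's residuals) from `n.Pos`, `0 < ε₂₉` AND THE THREE TERM-CONSTANT SIGNS OF `n`
ALONE** — the witness dag-lead WORDS-131 ∕ referee-D ⚑ EPS-PIN direct the small-row consumers to; NO `bg`, NO numerics clause of row P11.
[cite: Balaban1988Convergent, p.244, Thm 2 p.263, (3.16) p.268; Balaban1989LargeFieldI, (0.3)–(0.4) p.176, p.177 (i)–(ii); Balaban1989LargeFieldII, Thm 1 p.355 (not exercised)] -/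
theorem rOpLeaf_VOfRecord₁₃_theta13LiveOfNumerics (hn : n.Pos) (hε' : 0 < ε₂₉) (hκ : 0 ≤ n.s2.lf.κ) (hE₀ : 0 ≤ n.s2.lf.E₀) (hB₀ : 0 ≤ n.s2.lf.B₀) :
    ROpLeaf (VOfRecord₁₃ F N
      (theta13LiveOfNumerics F N n ε₂₉ (zeta316OfRecord F N n.ν n.τ9.M n.A₁) (RzOfRecord F N) (ZtOfRecord F N)) p) :=
  rOpLeaf_VOfRecord₁₃_liveRepin₁₃_of_hasResiduals F N (theta13OfNumerics F N n ε₂₉ _ _ _) p (hasResidualsOfRecord_theta13OfNumerics F N n ε₂₉)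
    (admissible_theta13OfNumerics F N _ _ _ hn hε') hκ hE₀ hB₀

/-- **The (R₁₃) slot in law form at `θ₁₃(n, ε₂₉)`** (same five sign hypotheses). [cite: Balaban1988Convergent, p.244 (bookkeeping); Balaban1989LargeFieldII, Thm 1 p.355 (not exercised)] -/
theorem laws₁₃_theta13LiveOfNumerics (hn : n.Pos) (hε' : 0 < ε₂₉) (hκ : 0 ≤ n.s2.lf.κ) (hE₀ : 0 ≤ n.s2.lf.E₀) (hB₀ : 0 ≤ n.s2.lf.B₀) :
    ∀ k, k < p.K →
      TLaw₁₃ F N (theta13LiveOfNumerics F N n ε₂₉ (zeta316OfRecord F N n.ν n.τ9.M n.A₁) (RzOfRecord F N) (ZtOfRecord F N)) p k →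
        SLaw₁₃ F N (theta13LiveOfNumerics F N n ε₂₉ (zeta316OfRecord F N n.ν n.τ9.M n.A₁) (RzOfRecord F N) (ZtOfRecord F N)) p (k + 1) :=
  (rOpLeaf_VOfRecord₁₃_iff F N _ p).mp (rOpLeaf_VOfRecord₁₃_theta13LiveOfNumerics F N p hn hε' hκ hE₀ hB₀)

/-- **`ρ_{k+1} = 𝐓ρ_k` a.e. at `θ₁₃(n, ε₂₉)` (K0b's residuals), `k < K`, no letter hypothesis.**
[cite: Balaban1989LargeFieldI, (0.2)–(0.4) p.176, p.177 (i)–(ii); Balaban1988Convergent, (3.16) p.268, (3.24)–(3.25) p.270] -/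
theorem densOfRecord₁₃_succ_ae_eq_tdens_theta13LiveOfNumerics (n : Stage12Numerics) (ε₂₉ : ℝ) (k : ℕ) (hk : k < p.K) :
    densOfRecord₁₃ F N (theta13LiveOfNumerics F N n ε₂₉ (zeta316OfRecord F N n.ν n.τ9.M n.A₁) (RzOfRecord F N) (ZtOfRecord F N)) p (k + 1)
      =ᵐ[fieldMeasure (F.P p.K) (k + 1) (SU N)]
      tdensOfRecord₁₃ F N (theta13LiveOfNumerics F N n ε₂₉ (zeta316OfRecord F N n.ν n.τ9.M n.A₁) (RzOfRecord F N) (ZtOfRecord F N)) p k :=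
  densOfRecord₁₃_succ_ae_eq_tdens_liveRepin₁₃_of_hasResiduals F N (theta13OfNumerics F N n ε₂₉ _ _ _) p
    (hasResidualsOfRecord_theta13OfNumerics F N n ε₂₉) k hk

end Numerics

section Thm1Witness

variable {ε₀ ε₂₉ B₃ a₀ a₁ : ℝ} (p : B12.RunParams)

/-- `θ₁₅`'s decay rate is `κ = 2·10⁴ ≥ 0`. [cite: Balaban1987RG1, (1.18) p.263 (bookkeeping witness)] -/
theorem kappa_nonneg_theta13OfThm1 (ε₀ ε₂₉ B₃ a₀ a₁ : ℝ) : 0 ≤ (theta13OfThm1 F N ε₀ ε₂₉ B₃ a₀ a₁).s2.lf.κ := by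
  rw [theta13OfThm1_κ]; norm_num

/-- `θ₁₅`'s term constants have `E₀ = 1 ≥ 0`. [cite: Balaban1988Convergent, (2.31) p.260 (bookkeeping witness)] -/
theorem E0_nonneg_theta13OfThm1 (ε₀ ε₂₉ B₃ a₀ a₁ : ℝ) : 0 ≤ (theta13OfThm1 F N ε₀ ε₂₉ B₃ a₀ a₁).s2.lf.E₀ := by
  have hE : (theta13OfThm1 F N ε₀ ε₂₉ B₃ a₀ a₁).s2.lf.E₀ = 1 := rfl
  rw [hE]; exact zero_le_one

/-- `θ₁₅`'s term constants have `B₀ = 1 ≥ 0`. [cite: Balaban1988Convergent, (2.42) p.261 (bookkeeping witness)] -/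
theorem B0_nonneg_theta13OfThm1 (ε₀ ε₂₉ B₃ a₀ a₁ : ℝ) : 0 ≤ (theta13OfThm1 F N ε₀ ε₂₉ B₃ a₀ a₁).s2.lf.B₀ := by
  have hB : (theta13OfThm1 F N ε₀ ε₂₉ B₃ a₀ a₁).s2.lf.B₀ = 1 := rfl
  rw [hB]; exact zero_le_one

/-- **★★ THE 𝐑-LEAF OF RECORD AT node00-def-K0a's [15]-KEYED WITNESS `θ₁₅ = theta13OfThm1 F N ε₀ ε₂₉ B₃ a₀ a₁` FROM ITS FIVE ADMISSIBILITY SIGNS ALONE** —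
`0 < ε₀`, `0 < ε₂₉`, `0 ≤ B₃`, `0 < a₀`, `0 < a₁`; NO [15] fact (`VariationalThm1Scaled[Sep]`), NO row P11 `bg`, NO numerics ∕ gauge clause: on the witness line
K0a FILE 10b ∕ 11b key K0‴ to, N13's (R₁₃) conjunct is a theorem outright (`θ₁₅` IS the all-numerics member at `stage12NumericsOfThm1`, `rfl`).
[cite: Balaban1988Convergent, p.244, Thm 2 p.263, (3.16) p.268; Balaban1989LargeFieldI, (0.3)–(0.4) p.176, p.177 (i)–(ii); Balaban1989LargeFieldII, Thm 1 p.355 (not exercised); Balaban1985Variational, Thm 1 p.279 (witness letters only)] -/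
theorem rOpLeaf_VOfRecord₁₃_theta13OfThm1 (hε : 0 < ε₀) (hε' : 0 < ε₂₉) (hB : 0 ≤ B₃) (ha₀ : 0 < a₀) (ha₁ : 0 < a₁) :
    ROpLeaf (VOfRecord₁₃ F N (theta13OfThm1 F N ε₀ ε₂₉ B₃ a₀ a₁) p) :=
  rOpLeaf_VOfRecord₁₃_theta13LiveOfNumerics F N p (stage12NumericsOfThm1_pos hε hB ha₀ ha₁) hε'
    (kappa_nonneg_theta13OfThm1 F N ε₀ ε₂₉ B₃ a₀ a₁) (E0_nonneg_theta13OfThm1 F N ε₀ ε₂₉ B₃ a₀ a₁) (B0_nonneg_theta13OfThm1 F N ε₀ ε₂₉ B₃ a₀ a₁)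

/-- **★★ The (R₁₃) slot in law form at `θ₁₅`, from the five signs alone.** [cite: Balaban1988Convergent, p.244 (bookkeeping); Balaban1989LargeFieldII, Thm 1 p.355 (not exercised)] -/
theorem laws₁₃_theta13OfThm1 (hε : 0 < ε₀) (hε' : 0 < ε₂₉) (hB : 0 ≤ B₃) (ha₀ : 0 < a₀) (ha₁ : 0 < a₁) :
    ∀ k, k < p.K → TLaw₁₃ F N (theta13OfThm1 F N ε₀ ε₂₉ B₃ a₀ a₁) p k → SLaw₁₃ F N (theta13OfThm1 F N ε₀ ε₂₉ B₃ a₀ a₁) p (k + 1) :=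
  (rOpLeaf_VOfRecord₁₃_iff F N _ p).mp (rOpLeaf_VOfRecord₁₃_theta13OfThm1 F N p hε hε' hB ha₀ ha₁)

/-- **The run's `rOperation` leaf reads TRUE at every world bound to the C-binding of record over `θ₁₅`'s Stage-13 view, from the five signs alone.**
[cite: Balaban1988Convergent, p.244; Balaban1989LargeFieldII, Thm 1 p.355 (bookkeeping at the record)] -/
theorem rOperation_leavesP_theta13OfThm1 (w : WorldP)
    (hup : w.up p = upOfRecord₅C F N ((theta13OfThm1 F N ε₀ ε₂₉ B₃ a₀ a₁).toStage5₁₃ F N) p)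
    (hε : 0 < ε₀) (hε' : 0 < ε₂₉) (hB : 0 ≤ B₃) (ha₀ : 0 < a₀) (ha₁ : 0 < a₁) : (leavesP w p).rOperation := by
  show (w.up p).rOperation
  rw [hup, rOperation_upOfRecord₅C_stage13_iff]
  exact laws₁₃_theta13OfThm1 F N p hε hε' hB ha₀ ha₁

/-- **`ρ_{k+1} = 𝐓ρ_k` a.e. at `θ₁₅`, `k < K`, NO letter hypothesis** — on K0a's [15]-keyed witness line 𝐑 of record is the identity up to null sets.
[cite: Balaban1989LargeFieldI, (0.2)–(0.4) p.176, p.177 (i)–(ii); Balaban1988Convergent, (3.16) p.268, (3.24)–(3.25) p.270] -/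
theorem densOfRecord₁₃_succ_ae_eq_tdens_theta13OfThm1 (ε₀ ε₂₉ B₃ a₀ a₁ : ℝ) (k : ℕ) (hk : k < p.K) :
    densOfRecord₁₃ F N (theta13OfThm1 F N ε₀ ε₂₉ B₃ a₀ a₁) p (k + 1) =ᵐ[fieldMeasure (F.P p.K) (k + 1) (SU N)]
      tdensOfRecord₁₃ F N (theta13OfThm1 F N ε₀ ε₂₉ B₃ a₀ a₁) p k :=
  densOfRecord₁₃_succ_ae_eq_tdens_theta13LiveOfNumerics F N p (stage12NumericsOfThm1 ε₀ B₃ a₀ a₁) ε₂₉ k hk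

/-- **THEOREM 1 [III] AT `θ₁₅` FROM THE FULL (S1ᵀ) AND THE FIVE SIGNS ALONE** (law reading). [cite: Balaban1988Convergent, Thm 1 p.262; Theorem p.245; p.244] -/
theorem sLaw₁₃_all_theta13OfThm1_of_thmP245 (hε : 0 < ε₀) (hε' : 0 < ε₂₉) (hB : 0 ≤ B₃) (ha₀ : 0 < a₀) (ha₁ : 0 < a₁)
    (hT : ∀ k, k < p.K → SLaw₁₃ F N (theta13OfThm1 F N ε₀ ε₂₉ B₃ a₀ a₁) p k → TLaw₁₃ F N (theta13OfThm1 F N ε₀ ε₂₉ B₃ a₀ a₁) p k) :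
    ∀ k, k ≤ p.K → SLaw₁₃ F N (theta13OfThm1 F N ε₀ ε₂₉ B₃ a₀ a₁) p k :=
  sLaw₁₃_all_of_laws F N _ p (laws₁₃_theta13OfThm1 F N p hε hε' hB ha₀ ha₁) hT

variable (w : WorldP) (h : (theta13OfThm1 F N ε₀ ε₂₉ B₃ a₀ a₁).Provisos₁₃ F N)

/-- **N11 · `Dag.B14_main (leavesP w P)` AT A WORLD BOUND TO `θ₁₅`'s DATUM — ONE DISPLAYED SLOT (S1ᵀ)** (the datum's binder `h : Provisos₁₃ θ₁₅` is K0a FILE 10b's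
`provisos₁₃_theta13OfThm1_of_thm1Scaled`; the (R₁₃) step inside is this file's theorem; `…B16RLeafRecord13AtLive` §5 by name at `n := stage12NumericsOfThm1`).
[cite: Balaban1988Convergent, Thm 1 p.262; Theorem p.245; p.244; (2.6) p.255] -/
theorem b14_main_at_record₁₃_theta13OfThm1 (hε : 0 < ε₀) (hε' : 0 < ε₂₉) (hB : 0 ≤ B₃) (ha₀ : 0 < a₀) (ha₁ : 0 < a₁)
    (hC : w.C = (datumOfRecord₁₃ F N (theta13OfThm1 F N ε₀ ε₂₉ B₃ a₀ a₁) h).C)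
    (hT : (leavesP w p).b7 → (leavesP w p).b8 → (leavesP w p).b9 → (leavesP w p).b10 → (leavesP w p).b11 →
      (leavesP w p).smallCouplings → (leavesP w p).smallFieldInductive → (leavesP w p).flowControl →
        ∀ k, k < p.K → SLaw₁₃ F N (theta13OfThm1 F N ε₀ ε₂₉ B₃ a₀ a₁) p k → TLaw₁₃ F N (theta13OfThm1 F N ε₀ ε₂₉ B₃ a₀ a₁) p k) :
    Dag.B14_main (leavesP w p) :=
  b14_main_at_record₁₃_theta13LiveOfNumerics F N _ _ _ p h w (stage12NumericsOfThm1_pos hε hB ha₀ ha₁) hε'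
    (kappa_nonneg_theta13OfThm1 F N ε₀ ε₂₉ B₃ a₀ a₁) (E0_nonneg_theta13OfThm1 F N ε₀ ε₂₉ B₃ a₀ a₁) (B0_nonneg_theta13OfThm1 F N ε₀ ε₂₉ B₃ a₀ a₁) hC hT

/-- **★ THE (B)-FACE's FIRST CONJUNCT `B16.Thm1Printed (datumOfRecord₁₃ θ₁₅ h).C` FROM THE FULL (S1ᵀ) along the windowed runs** (`0 < γ`; the five signs).
[cite: Balaban1989LargeFieldII, Thm 1 p.355; Balaban1988Convergent, Thm 1 p.262; Theorem p.245; p.244] -/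
theorem thm1Printed_datumOfRecord₁₃_theta13OfThm1_of_laws (hε : 0 < ε₀) (hε' : 0 < ε₂₉) (hB : 0 ≤ B₃) (ha₀ : 0 < a₀) (ha₁ : 0 < a₁)
    {γ : ℝ} (hγ : 0 < γ)
    (hT : ∀ P : B12.RunParams, ((datumOfRecord₁₃ F N (theta13OfThm1 F N ε₀ ε₂₉ B₃ a₀ a₁) h).C P).flow.InInterval γ P.K →
      ∀ k, k < P.K → SLaw₁₃ F N (theta13OfThm1 F N ε₀ ε₂₉ B₃ a₀ a₁) P k → TLaw₁₃ F N (theta13OfThm1 F N ε₀ ε₂₉ B₃ a₀ a₁) P k) :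
    B16.Thm1Printed (datumOfRecord₁₃ F N (theta13OfThm1 F N ε₀ ε₂₉ B₃ a₀ a₁) h).C :=
  thm1Printed_datumOfRecord₁₃_theta13LiveOfNumerics_of_laws F N _ _ _ h (stage12NumericsOfThm1_pos hε hB ha₀ ha₁) hε'
    (kappa_nonneg_theta13OfThm1 F N ε₀ ε₂₉ B₃ a₀ a₁) (E0_nonneg_theta13OfThm1 F N ε₀ ε₂₉ B₃ a₀ a₁) (B0_nonneg_theta13OfThm1 F N ε₀ ε₂₉ B₃ a₀ a₁) hγ hT

end Thm1Witness

section Thm1CWitness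

variable {ε₀ ε₂₉ B₃ a₀ a₁ : ℝ} (p : B12.RunParams)

/-- `θ₁₅ᶜ`'s decay rate is `κ = 2·10⁴ ≥ 0`. [cite: Balaban1987RG1, (1.18) p.263 (bookkeeping witness)] -/
theorem kappa_nonneg_theta13OfThm1C (ε₀ ε₂₉ B₃ a₀ a₁ : ℝ) : 0 ≤ (theta13OfThm1C F N ε₀ ε₂₉ B₃ a₀ a₁).s2.lf.κ := by
  rw [theta13OfThm1C_κ]; norm_num

/-- `θ₁₅ᶜ`'s term constants have `E₀ = 1 ≥ 0`. [cite: Balaban1988Convergent, (2.31) p.260 (bookkeeping witness)] -/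
theorem E0_nonneg_theta13OfThm1C (ε₀ ε₂₉ B₃ a₀ a₁ : ℝ) : 0 ≤ (theta13OfThm1C F N ε₀ ε₂₉ B₃ a₀ a₁).s2.lf.E₀ := by
  have hE : (theta13OfThm1C F N ε₀ ε₂₉ B₃ a₀ a₁).s2.lf.E₀ = 1 := rfl
  rw [hE]; exact zero_le_one

/-- `θ₁₅ᶜ`'s term constants have `B₀ = 1 ≥ 0`. [cite: Balaban1988Convergent, (2.42) p.261 (bookkeeping witness)] -/
theorem B0_nonneg_theta13OfThm1C (ε₀ ε₂₉ B₃ a₀ a₁ : ℝ) : 0 ≤ (theta13OfThm1C F N ε₀ ε₂₉ B₃ a₀ a₁).s2.lf.B₀ := by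
  have hB : (theta13OfThm1C F N ε₀ ε₂₉ B₃ a₀ a₁).s2.lf.B₀ = 1 := rfl
  rw [hB]; exact zero_le_one

/-- **★★ THE 𝐑-LEAF OF RECORD AT node00-def-K0a FILE 11a's `L`-KEYED [15]-KEYED WITNESS `θ₁₅ᶜ = theta13OfThm1C F N ε₀ ε₂₉ B₃ a₀ a₁` FROM ITS FIVE
ADMISSIBILITY SIGNS ALONE** (the witness K0a's `bgSep_theta13OfThm1C_of_thm1ScaledSep` — the separation-guarded row P11 — is stated at); NO [15] fact, NO `bg`,
NO numerics ∕ gauge ∕ run clause. [cite: Balaban1988Convergent, p.244, Thm 2 p.263, (3.16) p.268; Balaban1989LargeFieldI, (0.3)–(0.4) p.176, p.177 (i)–(ii); Balaban1989LargeFieldII, Thm 1 p.355 (not exercised); Balaban1985Variational, Thm 1 p.279 (witness letters only)] -/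
theorem rOpLeaf_VOfRecord₁₃_theta13OfThm1C (hε : 0 < ε₀) (hε' : 0 < ε₂₉) (hB : 0 ≤ B₃) (ha₀ : 0 < a₀) (ha₁ : 0 < a₁) :
    ROpLeaf (VOfRecord₁₃ F N (theta13OfThm1C F N ε₀ ε₂₉ B₃ a₀ a₁) p) :=
  rOpLeaf_VOfRecord₁₃_theta13LiveOfNumerics F N p (stage12NumericsOfThm1C_pos hε hB ha₀ ha₁) hε'
    (kappa_nonneg_theta13OfThm1C F N ε₀ ε₂₉ B₃ a₀ a₁) (E0_nonneg_theta13OfThm1C F N ε₀ ε₂₉ B₃ a₀ a₁) (B0_nonneg_theta13OfThm1C F N ε₀ ε₂₉ B₃ a₀ a₁)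

/-- **★★ The (R₁₃) slot in law form at `θ₁₅ᶜ`, from the five signs alone.** [cite: Balaban1988Convergent, p.244 (bookkeeping); Balaban1989LargeFieldII, Thm 1 p.355 (not exercised)] -/
theorem laws₁₃_theta13OfThm1C (hε : 0 < ε₀) (hε' : 0 < ε₂₉) (hB : 0 ≤ B₃) (ha₀ : 0 < a₀) (ha₁ : 0 < a₁) :
    ∀ k, k < p.K → TLaw₁₃ F N (theta13OfThm1C F N ε₀ ε₂₉ B₃ a₀ a₁) p k → SLaw₁₃ F N (theta13OfThm1C F N ε₀ ε₂₉ B₃ a₀ a₁) p (k + 1) :=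
  (rOpLeaf_VOfRecord₁₃_iff F N _ p).mp (rOpLeaf_VOfRecord₁₃_theta13OfThm1C F N p hε hε' hB ha₀ ha₁)

/-- **The run's `rOperation` leaf reads TRUE at every world bound to the C-binding of record over `θ₁₅ᶜ`'s Stage-13 view, from the five signs alone.**
[cite: Balaban1988Convergent, p.244; Balaban1989LargeFieldII, Thm 1 p.355 (bookkeeping at the record)] -/
theorem rOperation_leavesP_theta13OfThm1C (w : WorldP)
    (hup : w.up p = upOfRecord₅C F N ((theta13OfThm1C F N ε₀ ε₂₉ B₃ a₀ a₁).toStage5₁₃ F N) p)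
    (hε : 0 < ε₀) (hε' : 0 < ε₂₉) (hB : 0 ≤ B₃) (ha₀ : 0 < a₀) (ha₁ : 0 < a₁) : (leavesP w p).rOperation := by
  show (w.up p).rOperation
  rw [hup, rOperation_upOfRecord₅C_stage13_iff]
  exact laws₁₃_theta13OfThm1C F N p hε hε' hB ha₀ ha₁

/-- **`ρ_{k+1} = 𝐓ρ_k` a.e. at `θ₁₅ᶜ`, `k < K`, NO letter hypothesis.** [cite: Balaban1989LargeFieldI, (0.2)–(0.4) p.176, p.177 (i)–(ii); Balaban1988Convergent, (3.16) p.268, (3.24)–(3.25) p.270] -/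
theorem densOfRecord₁₃_succ_ae_eq_tdens_theta13OfThm1C (ε₀ ε₂₉ B₃ a₀ a₁ : ℝ) (k : ℕ) (hk : k < p.K) :
    densOfRecord₁₃ F N (theta13OfThm1C F N ε₀ ε₂₉ B₃ a₀ a₁) p (k + 1) =ᵐ[fieldMeasure (F.P p.K) (k + 1) (SU N)]
      tdensOfRecord₁₃ F N (theta13OfThm1C F N ε₀ ε₂₉ B₃ a₀ a₁) p k :=
  densOfRecord₁₃_succ_ae_eq_tdens_theta13LiveOfNumerics F N p (stage12NumericsOfThm1C F.L ε₀ B₃ a₀ a₁) ε₂₉ k hk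

/-- **THEOREM 1 [III] AT `θ₁₅ᶜ` FROM THE FULL (S1ᵀ) AND THE FIVE SIGNS ALONE** (law reading). [cite: Balaban1988Convergent, Thm 1 p.262; Theorem p.245; p.244] -/
theorem sLaw₁₃_all_theta13OfThm1C_of_thmP245 (hε : 0 < ε₀) (hε' : 0 < ε₂₉) (hB : 0 ≤ B₃) (ha₀ : 0 < a₀) (ha₁ : 0 < a₁)
    (hT : ∀ k, k < p.K → SLaw₁₃ F N (theta13OfThm1C F N ε₀ ε₂₉ B₃ a₀ a₁) p k → TLaw₁₃ F N (theta13OfThm1C F N ε₀ ε₂₉ B₃ a₀ a₁) p k) :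
    ∀ k, k ≤ p.K → SLaw₁₃ F N (theta13OfThm1C F N ε₀ ε₂₉ B₃ a₀ a₁) p k :=
  sLaw₁₃_all_of_laws F N _ p (laws₁₃_theta13OfThm1C F N p hε hε' hB ha₀ ha₁) hT

variable (w : WorldP) (h : (theta13OfThm1C F N ε₀ ε₂₉ B₃ a₀ a₁).Provisos₁₃ F N)

/-- **N11 · `Dag.B14_main (leavesP w P)` AT A WORLD BOUND TO `θ₁₅ᶜ`'s DATUM — ONE DISPLAYED SLOT (S1ᵀ)** (the datum's binder `h` is K0a FILE 11b's ∕ FILE 12's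
business; the (R₁₃) step inside is this file's theorem). [cite: Balaban1988Convergent, Thm 1 p.262; Theorem p.245; p.244; (2.6) p.255] -/
theorem b14_main_at_record₁₃_theta13OfThm1C (hε : 0 < ε₀) (hε' : 0 < ε₂₉) (hB : 0 ≤ B₃) (ha₀ : 0 < a₀) (ha₁ : 0 < a₁)
    (hC : w.C = (datumOfRecord₁₃ F N (theta13OfThm1C F N ε₀ ε₂₉ B₃ a₀ a₁) h).C)
    (hT : (leavesP w p).b7 → (leavesP w p).b8 → (leavesP w p).b9 → (leavesP w p).b10 → (leavesP w p).b11 →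
      (leavesP w p).smallCouplings → (leavesP w p).smallFieldInductive → (leavesP w p).flowControl →
        ∀ k, k < p.K → SLaw₁₃ F N (theta13OfThm1C F N ε₀ ε₂₉ B₃ a₀ a₁) p k → TLaw₁₃ F N (theta13OfThm1C F N ε₀ ε₂₉ B₃ a₀ a₁) p k) :
    Dag.B14_main (leavesP w p) :=
  b14_main_at_record₁₃_theta13LiveOfNumerics F N _ _ _ p h w (stage12NumericsOfThm1C_pos hε hB ha₀ ha₁) hε'
    (kappa_nonneg_theta13OfThm1C F N ε₀ ε₂₉ B₃ a₀ a₁) (E0_nonneg_theta13OfThm1C F N ε₀ ε₂₉ B₃ a₀ a₁) (B0_nonneg_theta13OfThm1C F N ε₀ ε₂₉ B₃ a₀ a₁)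
    hC hT

/-- **★ THE (B)-FACE's FIRST CONJUNCT `B16.Thm1Printed (datumOfRecord₁₃ θ₁₅ᶜ h).C` FROM THE FULL (S1ᵀ) along the windowed runs** (`0 < γ`; the five signs).
[cite: Balaban1989LargeFieldII, Thm 1 p.355; Balaban1988Convergent, Thm 1 p.262; Theorem p.245; p.244] -/
theorem thm1Printed_datumOfRecord₁₃_theta13OfThm1C_of_laws (hε : 0 < ε₀) (hε' : 0 < ε₂₉) (hB : 0 ≤ B₃) (ha₀ : 0 < a₀) (ha₁ : 0 < a₁)
    {γ : ℝ} (hγ : 0 < γ)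
    (hT : ∀ P : B12.RunParams, ((datumOfRecord₁₃ F N (theta13OfThm1C F N ε₀ ε₂₉ B₃ a₀ a₁) h).C P).flow.InInterval γ P.K →
      ∀ k, k < P.K → SLaw₁₃ F N (theta13OfThm1C F N ε₀ ε₂₉ B₃ a₀ a₁) P k → TLaw₁₃ F N (theta13OfThm1C F N ε₀ ε₂₉ B₃ a₀ a₁) P k) :
    B16.Thm1Printed (datumOfRecord₁₃ F N (theta13OfThm1C F N ε₀ ε₂₉ B₃ a₀ a₁) h).C :=
  thm1Printed_datumOfRecord₁₃_theta13LiveOfNumerics_of_laws F N _ _ _ h (stage12NumericsOfThm1C_pos hε hB ha₀ ha₁) hε'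
    (kappa_nonneg_theta13OfThm1C F N ε₀ ε₂₉ B₃ a₀ a₁) (E0_nonneg_theta13OfThm1C F N ε₀ ε₂₉ B₃ a₀ a₁) (B0_nonneg_theta13OfThm1C F N ε₀ ε₂₉ B₃ a₀ a₁)
    hγ hT

end Thm1CWitness

end Literature.MathematicalPhysics.QuantumFieldTheory.Balaban1983to89.B16RLeafRecord13LiveRstep
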